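import Literature.NumberTheory.LFunctions.ClassGroupUnsmoothing
import Literature.NumberTheory.LFunctions.UniformClassGroupPNT
import Literature.NumberTheory.LFunctions.UniformClassGroupPNTInputs
import Literature.NumberTheory.LFunctions.UniformClassGroupPNTGeneralDegree
import Literature.NumberTheory.LFunctions.UniformClassGroupPNTReduction
import Literature.NumberTheory.LFunctions.ClassGroupExplicitFormula
import Literature.NumberTheory.LFunctions.UniformClassGroupPNTGeneralDegreeInputs
import Literature.NumberTheory.LFunctions.DedekindZeta1LogFreeTheorem14
import Literature.NumberTheory.LFunctions.UniformClassGroupZeroSum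
import Literature.NumberTheory.LFunctions.ClassGroupLogFreeTheorem14AllDegrees
import Literature.NumberTheory.LFunctions.DedekindZeta1LogFreeTheorem14AllDegrees
import Literature.NumberTheory.LFunctions.DedekindResidueCondQnLowerBound
import Literature.NumberTheory.LFunctions.DeuringHeilbronn
import Literature.NumberTheory.LFunctions.ClassGroupLFunctionInversion
import Literature.NumberTheory.LFunctions.ClassGroupPNTSmoothedDeuringHeilbronn
import HarnessLib

/-!
# Thorner–Zaman (2019) Thm. 1.4 for the Hilbert class field at fixed degree, `θ_C`-form with the Landau–Siegel term — `ThornerZaman2019_classPNT_imaginaryQuadratic` HOLDS (re-homed proofs)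

**Thorner–Zaman (2019), Theorem 1.4, for the Hilbert class field `H_K/K` at a fixed degree `n > 1`, in `θ_C`-form with
the Landau–Siegel term and a decaying relative error** (`ClassPNT.classTheta_TZ_dichotomy`: there are `a, c₂, A, s > 0`
depending on `n` only such that for every number field `K` of degree `n`, with `Q = |d_K| nⁿ`, `h = h_K`,
`E(t) = e^{−c₂ log t/log Q} + e^{−√(c₂ log t)/√n}`, EITHER no real class group character has a real zero of `L(s, χ)` in
`(1 − 1/(8 log Q), 1)` and `|θ_C(t) − t/h| ≤ A E(t) t/h` for all classes `C` and `t ≥ Q^a`, OR there are a real `χ₁` and a real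
zero `β₁ ∈ (1 − 1/(8 log Q), 1)` of `L(s, χ₁)` with `Q^{−s} ≤ 1 − β₁` (Stark) and `|θ_C(t) − (t − χ₁(C) t^{β₁}/β₁)/h| ≤
A E(t) (t − χ₁(C) t^{β₁}/β₁)/h`) — J. Thorner, A. Zaman, Algebra Number Theory 13 (2019) 1039–1068, Thm. 1.4, Thm. 3.1–3.2,
Lemma 2.1, §5 [ThornerZaman2019]; A. Weiss, J. reine angew. Math. 338 (1983), Thm. 4.3, 5.2 [Weiss1983]; J. C. Lagarias,
H. L. Montgomery, A. M. Odlyzko, Invent. Math. 54 (1979) §7 [LagariasMontgomeryOdlyzko1979] — and the EXACT discharge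
`Literature.NumberTheory.LFunctions.NumberField.ThornerZaman2019_classPNT_imaginaryQuadratic_holds` of the Literature named
fact `ThornerZaman2019_classPNT_imaginaryQuadratic` (`UniformClassGroupPNT.lean`: [ThornerZaman2019, Thm. 1.4] for the ideal
classes of imaginary quadratic fields, `π_C`-form), via `n = 2` and the tree's reduction
`ThornerZaman2019_classPNT_imaginaryQuadratic_of_thetaForm` (`UniformClassGroupPNTReduction.lean`).  RE-HOMED into
`Literature/` by the Hodge foundations lane (`lit-hodgefound`, seat p20, generation 37): verbatim DECLARATION-LEVEL ports,
in dependency order and each with its original module docstring, of the theorem-only modules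
`Summits/QuantumAdvantage/QuantumAdvantage/Theorems/LinnikCubicClassGroupsDegreeOnePrimesEscape{ClassPNTDecayNumericsDH,
ClassPNTDHSmoothedDecay, PerCharacterDeficitUnsmoothing (3 declarations), ClassPNTTheta (5), ClassPNTDHThetaDecay,
ClassPNTTZFormPrelims, PerCharacterDeficitDensity (1), ClassPNTFamilyDensity, ResidueAllFields (3), ClassPNTDHLinnik (1),
ClassWindowDH (1), ClassPNTTZForm (1)}.lean`, namespace `Summit.QuantumAdvantage.QuantumAdvantage.Theorems.DegreeOnePrimesEscape`
re-rooted as `Literature.NumberTheory.LFunctions.NumberField.ClassPNT`; the smoothed layer is the sibling file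
`ClassGroupPNTSmoothedDeuringHeilbronn.lean`.

PROOF AS FORMALISED (= [ThornerZaman2019, §5] for this family; Part headers carry the details): the Deuring–Heilbronn regime of
the decay bookkeeping; the smoothed class sums with decaying error (`smoothedClassSum_dichotomy` with the Landau–Page package and
Deuring–Heilbronn `Literature…DeuringHeilbronn`); unsmoothing class by class with TRIVIAL short-interval bounds (no
Brun–Titchmarsh; `h_K ≤ Q⁴` absorbed by `x ≥ Q^{a}`) and the main terms `F_x(−1) = x + O(√x + εx)`, `F_x(−β) = x^β/β + O(…)`;
the log-free zero density for the family in `Q`-form (`fam_density_local`, from the tree's `ClassGroupLogFreeTheorem14AllDegrees`);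
the residue bound `κ_K ≥ Q^{−A(n)}` in every degree; the window dichotomy and the Linnik-type deduction; and the assembly
`classTheta_TZ_dichotomy` by the case analysis of [ThornerZaman2019, §5] (a zero on the exceptional segment is the `β₁` of the
second branch; off the segment a real zero in the window has `1 − β ≥ c/log Q` and its term is part of the error; with no real zero
in the window the first branch holds).  GRH-free and Siegel-free (all constants effective in principle; none computed).
Theorem-only file: no definition, no new named fact (D-0026); imports Mathlib/Literature only.  Its only previous proof was the
Summits-side twin, which `Literature/` cannot import; the Summits originals stay in place (transitional duplication).  The
general-degree named fact `ThornerZaman2019_classPNT_hilbertClassField` (constants uniform in the degree) is NOT discharged.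
Nothing here bears on any summit statement.
-/

noncomputable section

/-!
## Part 1 — port of `Summits/QuantumAdvantage/QuantumAdvantage/Theorems/LinnikCubicClassGroupsDegreeOnePrimesEscapeClassPNTDecayNumericsDH.lean` (2 declarations kept)

# The class prime number theorem with DECAYING error, I′: the Deuring–Heilbronn regime

Sequel of `…ClassPNTDecayNumerics.lean` (decay shape `𝓓_κ(x) = e^{−κ log x/log Q} + e^{−√(κ log x)}`):

* `dhRegime_zeroSum_decay` — the decaying twin of `dhRegime_zeroSum_small` (`…ClassPNTDHNumerics.lean`):
  in the Deuring–Heilbronn regime `2Cnη₁ ≤ 1/3` (`η₁ = (1 − β₁) log x`), with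
  `c_Z = min(log(1/(2Cnη₁))/(Cn), a log Q/2)` and `L = log x ≥ a₁ log Q`:
  `A₀ (e^{−c_Z L/(4a log Q)} + e^{−√(c_Z L/4)}) ≤ (6Cn + 1) A₀ · η₁ · 𝓓_κ(x)`, `κ = 1/(32 a (Cn + 1))` —
  the error is SMALL RELATIVE TO the main term `x − x^{β₁}/β₁ ≍ x η₁` AND decays in `x`
  ([ThornerZaman2019, §5, proof of Thm. 5.1]).

Reference: J. Thorner, A. Zaman, *A unified and improved Chebotarev density theorem*, Algebra Number
Theory 13 (2019), §5 [ThornerZaman2019].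
-/

section Part1

open _root_.Real

namespace Literature.NumberTheory.LFunctions.NumberField.ClassPNT

/-! ### The Deuring–Heilbronn regime -/

/-- `1 ≤ log 3`. [folklore] -/
private theorem one_le_log_three : (1 : ℝ) ≤ Real.log 3 := by
  rw [Real.le_log_iff_exp_le (by norm_num)]
  have := Real.exp_one_lt_d9; linarith

set_option maxHeartbeats 800000 in
/-- **The zero sum in the Deuring–Heilbronn regime, decaying form.**  With `η₁ = (1 − β₁) log x` in the
regime `2Cnη₁ ≤ 1/3`, `η₁ ≥ c₁ e^{−2 log Q}`, and `c_Z = min(log(1/(2Cnη₁))/(Cn), a log Q/2)`, for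
`L ≥ a₁ log Q` with `a₁ ≥ 8aCn`, `a₁ ≥ 32Cn + 16Cn·max(0, log(1/(2Cnc₁)))`,
`a₁ ≥ 32 (2 + max(0, log(1/c₁)))²`:
`A₀ (e^{−c_Z L/(4a log Q)} + e^{−√(c_Z L/4)}) ≤ (6Cn + 1) A₀ η₁ (e^{−κL/log Q} + e^{−√(κL)})`,
`κ = 1/(32 a (Cn + 1))`.  (First alternative of the `min`, `u = 2Cnη₁ ≤ 1/3`, `ℓ = log(1/u) ≥ 1`:
`e^{−ℓm} ≤ u · e · e^{−m}` for `m = L/(4aCn log Q) ≥ 2`, and `√(ℓL/(4Cn)) ≥ ℓ + √(κL)` since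
`L ≥ 16Cnℓ`; second alternative: both exponentials are `≤ c₁ e^{−2 log Q} · 𝓓 ≤ η₁ 𝓓`.)
[cite: ThornerZaman2019, §5] -/
theorem dhRegime_zeroSum_decay {A₀ C n η₁ c₁ a lQ L a₁ : ℝ} (hA₀ : 0 < A₀) (hC : 0 < C)
    (hn : 2 ≤ n) (hc₁ : 0 < c₁) (ha : 1 ≤ a) (hlQ : 1 ≤ lQ) (hη₁0 : 0 < η₁)
    (hη₁low : c₁ * Real.exp (-(2 * lQ)) ≤ η₁) (hη₁C : 2 * C * n * η₁ ≤ 1 / 3)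
    (hL : a₁ * lQ ≤ L) (ha₁1 : 8 * a * C * n ≤ a₁)
    (ha₁2 : 32 * C * n + 16 * C * n * max 0 (Real.log (1 / (2 * C * n * c₁))) ≤ a₁)
    (ha₁3 : 32 * (2 + max 0 (Real.log (1 / c₁))) ^ 2 ≤ a₁) :
    A₀ * (Real.exp (-(min (Real.log (1 / (2 * C * n * η₁)) / (C * n)) (a * lQ / 2) * L / (4 * a * lQ))) +
      Real.exp (-Real.sqrt (min (Real.log (1 / (2 * C * n * η₁)) / (C * n)) (a * lQ / 2) * L / 4))) ≤
      (6 * C * n + 1) * A₀ * η₁ *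
        (Real.exp (-(1 / (32 * a * (C * n + 1)) * L / lQ)) +
          Real.exp (-Real.sqrt (1 / (32 * a * (C * n + 1)) * L))) := by
  have hn0 : 0 < n := by linarith
  have hCn : 0 < C * n := mul_pos hC hn0
  have haCn : 0 < 8 * a * C * n := by positivity
  have ha₁0 : 0 < a₁ := lt_of_lt_of_le haCn ha₁1
  have hlQ0 : 0 < lQ := by linarith
  set κ : ℝ := 1 / (32 * a * (C * n + 1)) with hκ
  have hκ0 : 0 < κ := by positivity
  have hκ1 : κ ≤ 1 / (4 * a * (C * n)) := by
    rw [hκ]; exact one_div_le_one_div_of_le (by positivity) (by nlinarith)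
  have hκ2 : κ ≤ 1 / (16 * (C * n)) := by
    rw [hκ]; exact one_div_le_one_div_of_le (by positivity) (by nlinarith)
  have hκ3 : κ ≤ 1 / 32 := by
    rw [hκ]; exact one_div_le_one_div_of_le (by positivity) (by nlinarith)
  set u : ℝ := 2 * C * n * η₁ with hu
  have hu0 : 0 < u := by positivity
  have hu3 : u ≤ 1 / 3 := hη₁C
  set ℓ : ℝ := Real.log (1 / u) with hℓ
  have hℓ1 : 1 ≤ ℓ := by
    rw [hℓ]
    refine one_le_log_three.trans (Real.log_le_log (by norm_num) ?_)
    rw [le_div_iff₀ hu0]; linarith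
  have hℓ0 : 0 ≤ ℓ := by linarith
  have heℓ : Real.exp (-ℓ) = u := by
    rw [hℓ, Real.exp_neg, Real.exp_log (by positivity), one_div, inv_inv]
  have hLa₁ : a₁ ≤ L := by
    have : a₁ * 1 ≤ a₁ * lQ := mul_le_mul_of_nonneg_left hlQ ha₁0.le
    linarith
  have hL0 : 0 < L := by linarith
  have hD0 : 0 < Real.exp (-(κ * L / lQ)) + Real.exp (-Real.sqrt (κ * L)) := by positivity
  -- the decay shape dominates `e^{-κ L}`
  have hκL : Real.exp (-(κ * L)) ≤ Real.exp (-(κ * L / lQ)) := exp_neg_mul_le_exp_neg_div hκ0.le hL0.le hlQ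
  rcases le_total (ℓ / (C * n)) (a * lQ / 2) with hcase | hcase
  · -- first alternative: `c_Z = ℓ/(Cn)`
    rw [min_eq_left hcase]
    -- `ℓ ≤ 2 lQ + κ₁`
    set κ₁ : ℝ := max 0 (Real.log (1 / (2 * C * n * c₁))) with hκ₁
    have hκ₁0 : 0 ≤ κ₁ := le_max_left _ _
    have hℓle : ℓ ≤ 2 * lQ + κ₁ := by
      have h1 : 1 / u ≤ Real.exp (2 * lQ) / (2 * C * n * c₁) := by
        rw [hu, div_le_div_iff₀ hu0 (by positivity), one_mul]
        have := mul_le_mul_of_nonneg_left hη₁low (by positivity : (0 : ℝ) ≤ 2 * C * n)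
        calc 2 * C * n * c₁ = 2 * C * n * (c₁ * Real.exp (-(2 * lQ))) * Real.exp (2 * lQ) := by
              rw [Real.exp_neg]; field_simp
          _ ≤ 2 * C * n * η₁ * Real.exp (2 * lQ) := mul_le_mul_of_nonneg_right this (by positivity)
          _ = Real.exp (2 * lQ) * (2 * C * n * η₁) := by ring
      have h2 : ℓ ≤ Real.log (Real.exp (2 * lQ) / (2 * C * n * c₁)) :=
        Real.log_le_log (by positivity) h1
      rw [Real.log_div (by positivity) (by positivity), Real.log_exp] at h2
      have h3 : -Real.log (2 * C * n * c₁) ≤ κ₁ := by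
        rw [← Real.log_inv, ← one_div]; exact le_max_right _ _
      linarith
    -- `L ≥ 16 C n ℓ` and `L ≥ 8 a C n lQ`
    have hL16 : 16 * (C * n) * ℓ ≤ L := by
      have h1 : 16 * (C * n) * ℓ ≤ 16 * (C * n) * (2 * lQ + κ₁) :=
        mul_le_mul_of_nonneg_left hℓle (by positivity)
      have h2 : (32 * C * n + 16 * C * n * κ₁) * lQ ≤ a₁ * lQ :=
        mul_le_mul_of_nonneg_right ha₁2 (by linarith)
      have h3 : 16 * C * n * κ₁ * 1 ≤ 16 * C * n * κ₁ * lQ :=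
        mul_le_mul_of_nonneg_left hlQ (by positivity)
      have e1 : 16 * (C * n) * (2 * lQ + κ₁) = 32 * C * n * lQ + 16 * C * n * κ₁ := by ring
      have e2 : (32 * C * n + 16 * C * n * κ₁) * lQ = 32 * C * n * lQ + 16 * C * n * κ₁ * lQ := by ring
      linarith
    have hL8 : 2 * (4 * a * lQ * (C * n)) ≤ L := by
      have h1 := mul_le_mul_of_nonneg_right ha₁1 (by linarith : (0 : ℝ) ≤ lQ)
      have e : 2 * (4 * a * lQ * (C * n)) = 8 * a * C * n * lQ := by ring
      linarith
    -- first exponential: `e^{-ℓ m} ≤ u e e^{-m}`, `m = L/(4 a C n lQ) ≥ 2`, and `e^{-m} ≤ e^{-κ L/lQ}`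
    set m : ℝ := L / (4 * a * lQ * (C * n)) with hm
    have hm2 : 2 ≤ m := by rw [hm, le_div_iff₀ (by positivity)]; exact hL8
    have hE1 : Real.exp (-(ℓ / (C * n) * L / (4 * a * lQ))) ≤ u * (Real.exp 1 * Real.exp (-(κ * L / lQ))) := by
      have e1 : ℓ / (C * n) * L / (4 * a * lQ) = ℓ * m := by rw [hm]; field_simp
      rw [e1]
      have h1 : ℓ + (m - 1) ≤ ℓ * m := by nlinarith
      have h2 : Real.exp (-(ℓ * m)) ≤ Real.exp (-ℓ) * Real.exp (-(m - 1)) := by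
        rw [← Real.exp_add, Real.exp_le_exp]; linarith
      have h3 : Real.exp (-(m - 1)) = Real.exp 1 * Real.exp (-m) := by
        rw [← Real.exp_add]; ring_nf
      have h4 : Real.exp (-m) ≤ Real.exp (-(κ * L / lQ)) := by
        rw [Real.exp_le_exp, neg_le_neg_iff, hm]
        rw [show κ * L / lQ = κ * (4 * a * (C * n)) * (L / (4 * a * lQ * (C * n))) by field_simp]
        have : κ * (4 * a * (C * n)) ≤ 1 := by
          have := (le_div_iff₀ (by positivity : (0:ℝ) < 4 * a * (C * n))).1 hκ1
          linarith
        have hq : 0 ≤ L / (4 * a * lQ * (C * n)) := by positivity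
        nlinarith
      rw [heℓ, h3] at h2
      calc Real.exp (-(ℓ * m)) ≤ u * (Real.exp 1 * Real.exp (-m)) := h2
        _ ≤ u * (Real.exp 1 * Real.exp (-(κ * L / lQ))) :=
            mul_le_mul_of_nonneg_left (mul_le_mul_of_nonneg_left h4 (Real.exp_pos _).le) hu0.le
    -- second exponential: `√(ℓ L/(4Cn)) ≥ ℓ + √(κ L)`
    have hE2 : Real.exp (-Real.sqrt (ℓ / (C * n) * L / 4)) ≤ u * Real.exp (-Real.sqrt (κ * L)) := by
      -- `ℓ + √(κ L) ≤ √(ℓ L /(4Cn))`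
      have hS : ℓ + Real.sqrt (κ * L) ≤ Real.sqrt (ℓ / (C * n) * L / 4) := by
        have e1 : ℓ / (C * n) * L / 4 = ℓ * (L / (4 * (C * n))) := by field_simp
        rw [e1]
        -- `2ℓ ≤ √` and `2√(κL) ≤ √`
        have hA : (2 * ℓ) ^ 2 ≤ ℓ * (L / (4 * (C * n))) := by
          have h2 : 4 * ℓ ≤ L / (4 * (C * n)) := by
            rw [le_div_iff₀ (by positivity)]
            have e : 4 * ℓ * (4 * (C * n)) = 16 * (C * n) * ℓ := by ring
            linarith
          have := mul_le_mul_of_nonneg_left h2 hℓ0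
          nlinarith
        have hB : (2 * Real.sqrt (κ * L)) ^ 2 ≤ ℓ * (L / (4 * (C * n))) := by
          rw [mul_pow, Real.sq_sqrt (by positivity)]
          have h2 : 4 * κ ≤ 1 / (4 * (C * n)) := by
            have := hκ2
            rw [show 1 / (16 * (C * n)) = 1 / (4 * (C * n)) / 4 by field_simp; ring] at this
            linarith
          have h3 : 4 * κ * L ≤ 1 * (L / (4 * (C * n))) := by
            rw [one_mul, le_div_iff₀ (by positivity)]
            have := mul_le_mul_of_nonneg_right h2 hL0.le
            rw [div_mul_eq_mul_div, le_div_iff₀ (by positivity)] at this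
            linarith
          have h4 : 1 * (L / (4 * (C * n))) ≤ ℓ * (L / (4 * (C * n))) :=
            mul_le_mul_of_nonneg_right hℓ1 (by positivity)
          linarith
        have hA' : 2 * ℓ ≤ Real.sqrt (ℓ * (L / (4 * (C * n)))) := Real.le_sqrt_of_sq_le hA
        have hB' : 2 * Real.sqrt (κ * L) ≤ Real.sqrt (ℓ * (L / (4 * (C * n)))) := Real.le_sqrt_of_sq_le hB
        linarith
      rw [← heℓ, ← Real.exp_add, Real.exp_le_exp]
      linarith
    -- assemble: `A₀ (u e 𝓓₁ + u 𝓓₂) ≤ 6 C n A₀ η₁ 𝓓 ≤ (6Cn+1) A₀ η₁ 𝓓`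
    have he3 : Real.exp 1 ≤ 3 := by have := Real.exp_one_lt_d9; linarith
    have hD1 : 0 < Real.exp (-(κ * L / lQ)) := Real.exp_pos _
    have hD2 : 0 < Real.exp (-Real.sqrt (κ * L)) := Real.exp_pos _
    calc A₀ * (Real.exp (-(ℓ / (C * n) * L / (4 * a * lQ))) + Real.exp (-Real.sqrt (ℓ / (C * n) * L / 4)))
        ≤ A₀ * (u * (Real.exp 1 * Real.exp (-(κ * L / lQ))) + u * Real.exp (-Real.sqrt (κ * L))) :=
          mul_le_mul_of_nonneg_left (add_le_add hE1 hE2) hA₀.le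
      _ ≤ A₀ * (u * (3 * Real.exp (-(κ * L / lQ))) + u * (3 * Real.exp (-Real.sqrt (κ * L)))) := by
          refine mul_le_mul_of_nonneg_left (add_le_add ?_ ?_) hA₀.le
          · exact mul_le_mul_of_nonneg_left (mul_le_mul_of_nonneg_right he3 hD1.le) hu0.le
          · refine mul_le_mul_of_nonneg_left ?_ hu0.le
            linarith
      _ = 6 * C * n * A₀ * η₁ * (Real.exp (-(κ * L / lQ)) + Real.exp (-Real.sqrt (κ * L))) := by
          rw [hu]; ring
      _ ≤ (6 * C * n + 1) * A₀ * η₁ * (Real.exp (-(κ * L / lQ)) + Real.exp (-Real.sqrt (κ * L))) := by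
          have h0 : 0 ≤ A₀ * η₁ * (Real.exp (-(κ * L / lQ)) + Real.exp (-Real.sqrt (κ * L))) := by
            positivity
          have e : (6 * C * n + 1) * A₀ * η₁ * (Real.exp (-(κ * L / lQ)) + Real.exp (-Real.sqrt (κ * L))) =
              6 * C * n * A₀ * η₁ * (Real.exp (-(κ * L / lQ)) + Real.exp (-Real.sqrt (κ * L))) +
                A₀ * η₁ * (Real.exp (-(κ * L / lQ)) + Real.exp (-Real.sqrt (κ * L))) := by ring
          linarith
  · -- second alternative: `c_Z = a lQ / 2`
    rw [min_eq_right hcase]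
    set Λ : ℝ := max 0 (Real.log (1 / c₁)) with hΛ
    have hΛ0 : 0 ≤ Λ := le_max_left _ _
    -- `e^{-Λ} ≤ c₁`
    have heΛ : Real.exp (-Λ) ≤ c₁ := by
      rw [Real.exp_neg]
      have h1 : 1 / c₁ ≤ Real.exp Λ := by
        calc 1 / c₁ = Real.exp (Real.log (1 / c₁)) := (Real.exp_log (by positivity)).symm
          _ ≤ Real.exp Λ := Real.exp_le_exp.2 (le_max_right _ _)
      calc (Real.exp Λ)⁻¹ ≤ (1 / c₁)⁻¹ := inv_anti₀ (by positivity) h1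
        _ = c₁ := by rw [one_div, inv_inv]
    -- `e^{-(2+Λ) lQ} ≤ η₁`
    have hE : Real.exp (-((2 + Λ) * lQ)) ≤ η₁ := by
      have h1 : Real.exp (-((2 + Λ) * lQ)) ≤ Real.exp (-(2 * lQ)) * Real.exp (-Λ) := by
        rw [← Real.exp_add, Real.exp_le_exp]
        have : Λ * 1 ≤ Λ * lQ := mul_le_mul_of_nonneg_left hlQ hΛ0
        linarith
      refine h1.trans ?_
      calc Real.exp (-(2 * lQ)) * Real.exp (-Λ) ≤ Real.exp (-(2 * lQ)) * c₁ :=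
            mul_le_mul_of_nonneg_left heΛ (by positivity)
        _ = c₁ * Real.exp (-(2 * lQ)) := by ring
        _ ≤ η₁ := hη₁low
    have h2Λ : 2 ≤ 2 + Λ := by linarith
    have ha₁' : 16 * (2 + Λ) ≤ a₁ := by
      have : (2 + Λ) ≤ (2 + Λ) ^ 2 := by nlinarith
      nlinarith
    -- first exponential: `e^{-L/8} = e^{-L/16} e^{-L/16} ≤ η₁ e^{-κ L/lQ}`
    have hE1 : Real.exp (-(a * lQ / 2 * L / (4 * a * lQ))) ≤ η₁ * Real.exp (-(κ * L / lQ)) := by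
      rw [show a * lQ / 2 * L / (4 * a * lQ) = L / 16 + L / 16 by field_simp; ring, neg_add, Real.exp_add]
      refine mul_le_mul ?_ ?_ (Real.exp_pos _).le hη₁0.le
      · refine le_trans (Real.exp_le_exp.2 ?_) hE
        have h1 : 16 * (2 + Λ) * lQ ≤ a₁ * lQ := mul_le_mul_of_nonneg_right ha₁' (by linarith)
        nlinarith
      · refine le_trans (Real.exp_le_exp.2 ?_) hκL
        have : κ * L ≤ 1 / 32 * L := mul_le_mul_of_nonneg_right hκ3 hL0.le
        linarith
    -- second exponential: `√(a lQ L / 8) ≥ (2+Λ) lQ + √(κ L)`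
    have hE2 : Real.exp (-Real.sqrt (a * lQ / 2 * L / 4)) ≤ η₁ * Real.exp (-Real.sqrt (κ * L)) := by
      have hS : (2 + Λ) * lQ + Real.sqrt (κ * L) ≤ Real.sqrt (a * lQ / 2 * L / 4) := by
        have hmono : Real.sqrt (lQ * L / 8) ≤ Real.sqrt (a * lQ / 2 * L / 4) := by
          refine Real.sqrt_le_sqrt ?_
          rw [show a * lQ / 2 * L / 4 = a * (lQ * L / 8) by ring]
          have h0 : 0 ≤ lQ * L / 8 := by positivity
          nlinarith
        have hA : (2 * ((2 + Λ) * lQ)) ^ 2 ≤ lQ * L / 8 := by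
          have h3 : 32 * (2 + Λ) ^ 2 * lQ ≤ a₁ * lQ := mul_le_mul_of_nonneg_right ha₁3 (by linarith)
          have h4 : a₁ * lQ * lQ ≤ L * lQ := mul_le_mul_of_nonneg_right hL (by linarith)
          nlinarith
        have hB : (2 * Real.sqrt (κ * L)) ^ 2 ≤ lQ * L / 8 := by
          rw [mul_pow, Real.sq_sqrt (by positivity)]
          have : κ * L ≤ 1 / 32 * L := mul_le_mul_of_nonneg_right hκ3 hL0.le
          have : 1 * L ≤ lQ * L := mul_le_mul_of_nonneg_right hlQ hL0.le
          nlinarith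
        have hA' := Real.le_sqrt_of_sq_le hA
        have hB' := Real.le_sqrt_of_sq_le hB
        linarith
      have h1 : Real.exp (-Real.sqrt (a * lQ / 2 * L / 4)) ≤
          Real.exp (-((2 + Λ) * lQ)) * Real.exp (-Real.sqrt (κ * L)) := by
        rw [← Real.exp_add, Real.exp_le_exp]; linarith
      exact h1.trans (mul_le_mul_of_nonneg_right hE (Real.exp_pos _).le)
    calc A₀ * (Real.exp (-(a * lQ / 2 * L / (4 * a * lQ))) + Real.exp (-Real.sqrt (a * lQ / 2 * L / 4)))
        ≤ A₀ * (η₁ * Real.exp (-(κ * L / lQ)) + η₁ * Real.exp (-Real.sqrt (κ * L))) :=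
          mul_le_mul_of_nonneg_left (add_le_add hE1 hE2) hA₀.le
      _ = 1 * A₀ * η₁ * (Real.exp (-(κ * L / lQ)) + Real.exp (-Real.sqrt (κ * L))) := by ring
      _ ≤ (6 * C * n + 1) * A₀ * η₁ * (Real.exp (-(κ * L / lQ)) + Real.exp (-Real.sqrt (κ * L))) := by
          refine mul_le_mul_of_nonneg_right (mul_le_mul_of_nonneg_right
            (mul_le_mul_of_nonneg_right (by nlinarith) hA₀.le) hη₁0.le) hD0.le

end Literature.NumberTheory.LFunctions.NumberField.ClassPNT

end Part1

/-!
## Part 2 — port of `Summits/QuantumAdvantage/QuantumAdvantage/Theorems/LinnikCubicClassGroupsDegreeOnePrimesEscapeClassPNTDHSmoothedDecay.lean` (1 declarations kept)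

# The class prime number theorem with DECAYING error, II: the smoothed class sums

`smoothedClassSum_decay` is the DECAYING-ERROR twin of `smoothedClassSum_dichotomy_dh`
(`…ClassPNTDHSmoothed.lean`).  There, given the Deuring–Heilbronn phenomenon (hypothesis `hDH`, the
statement of `Literature.NumberTheory.LFunctions.NumberField.deuringHeilbronn` verbatim) and the family density
bound in `Q`-form, the smoothed class sums `h ψ̃_C` were shown to be within `η x` (resp.
`η x min(1, (1 − β₁) log x)` in the exceptional case) of their main terms for `x ≥ Q^{a₁(η)}`, for each FIXED
`η > 0`.  Here the dependence on `x` is kept, as in [ThornerZaman2019, §5, proof of Thm. 5.1]: with the decay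
shape

  `𝓓_κ(x) = e^{−κ log x / log Q} + e^{−√(κ log x)}`      (`Q = |d_K| n^n`, `κ = κ(n) > 0`),

for every number field `K` of degree `n` obeying the density bound and every `x ≥ Q^{a₁}`, `a₁ = a₁(n)`:
(A) if NO zero of the family lies on the exceptional segment `excRegion c K`, then
  `‖h ψ̃_C(g_x) − F(−1)‖ ≤ A x 𝓓_κ(x)` for every class `C`;
(B) if `ρ₁` is a zero of `F_{ψ₁}` on the exceptional segment, then `ρ₁ = β₁` is real, `ψ₁` is real, and
  `‖h ψ̃_C(g_x) − F(−1) + ψ₁(C⁻¹) F(−β₁)‖ ≤ A x 𝓓_κ(x) · min(1, (1 − β₁) log x)` for every class `C`.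
The zero terms off the segment are bounded by `fam_zeroSum_le_local_zfr` with the classical zero-free constant
when `(1 − β₁) log x` is not small and with the Deuring–Heilbronn constant
`c_Z = min(log(1/(2Cn(1 − β₁) log x))/(Cn), a log Q/2)` (`zfr_of_zeroRepulsion`) when it is
(`dhRegime_zeroSum_decay`), through the core estimate `smoothedClassSum_decay_core`
(`…ClassPNTDHSmoothedDecayCore.lean`); the junk terms `A_J x^{1−ν}` are `≤ A_J x e^{−(ν/4) log x} · c₁Q^{−2}`
(`rpow_one_sub_decay`) and `c₁ Q^{−2} ≤ 1 − β₁` is Stark's effective bound.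
References: J. Thorner, A. Zaman, Algebra Number Theory 13 (2019), Thm. 1.4 / §5 [ThornerZaman2019];
J. C. Lagarias, H. L. Montgomery, A. M. Odlyzko, Invent. Math. 54 (1979), §7 [LagariasMontgomeryOdlyzko1979];
A. Weiss, J. reine angew. Math. 338 (1983) [Weiss1983].
-/

section Part2

open _root_.Complex _root_.Real _root_.MeasureTheory _root_.Set _root_.Filter _root_.Topology
open scoped _root_.NumberField nonZeroDivisors

namespace Literature.NumberTheory.LFunctions.NumberField.ClassPNT

open Literature.NumberTheory.LFunctions Literature.NumberTheory.LFunctions.NumberField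
  Literature.NumberTheory.LFunctions.EntireEF Literature.NumberTheory.LFunctions.TZWeight
  Literature.NumberTheory.LFunctions.AbelianDensity

set_option maxHeartbeats 3200000 in
/-- **The smoothed class sums of a number field of degree `n`, two-sided, with the exceptional zero of the
family, the Deuring–Heilbronn phenomenon and DECAYING error** (see the module docstring).
[cite: ThornerZaman2019, Theorem 1.4 and §5] [cite: LagariasMontgomeryOdlyzko1979, §7] -/
theorem smoothedClassSum_decay (n : ℕ) (hn : 1 < n) {b D a : ℝ} (hb : 0 < b) (hD : 0 < D)
    (ha : 1 ≤ a)
    (hDH : ∃ C : ℝ, 0 < C ∧ ∀ (K : Type) [Field K] [NumberField K] (χ₁ : ClassGroup (𝓞 K) →* ℂˣ),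
      χ₁ * χ₁ = 1 → ∀ β₁ : ℝ, 0 < β₁ → β₁ < 1 → classGroupLFunction K χ₁ β₁ = 0 →
      ∀ (χ : ClassGroup (𝓞 K) →* ℂˣ) (ρ : ℂ), classGroupLFunction K χ ρ = 0 → 1 / 2 ≤ ρ.re → ρ ≠ 1 →
        ρ ≠ β₁ →
        Real.log (1 / (C * (Real.log ((NumberField.discr K).natAbs : ℝ) +
            Module.finrank ℚ K * (Real.log (|ρ.im| + 2) + 1)) * (1 - β₁))) /
          (C * (Real.log ((NumberField.discr K).natAbs : ℝ) +
            Module.finrank ℚ K * (Real.log (|ρ.im| + 2) + 1))) ≤ 1 - ρ.re) :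
    ∃ ν a₁ c κ A : ℝ, 0 < ν ∧ ν ≤ 1 / 64 ∧ 1 ≤ a₁ ∧ 0 < c ∧ c ≤ 1 / (8 * ((n : ℝ) ^ 2 + 1)) ∧
      0 < κ ∧ 0 < A ∧
    ∀ (K : Type) [Field K] [NumberField K], Module.finrank ℚ K = n →
      (∀ (T : ℝ), 1 ≤ T → ∀ u : AddChar (Additive (ClassGroup (𝓞 K))) ℂ → Finset ℂ,
        (∀ ψ, ∀ ρ ∈ u ψ, famF K ψ ρ = 0 ∧ 1 / 4 ≤ ρ.re ∧ ρ.re < 1 ∧ |ρ.im| ≤ T) →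
        ∀ α : ℝ, α ≤ 1 →
          ∑ ψ, ∑ ρ ∈ u ψ with α ≤ ρ.re, (famMult K ψ ρ : ℝ) ≤
            D * Real.exp (b * (a * Real.log (ThornerZaman.condQn K) + Real.log (T + 4))) ^ (1 - α)) →
      ((∀ (ψ : AddChar (Additive (ClassGroup (𝓞 K))) ℂ) (ρ : ℂ), famF K ψ ρ = 0 → 0 < ρ.re →
          ρ.re < 1 → ¬ excRegion c K ρ) →
        ∀ x : ℝ, ThornerZaman.condQn K ^ a₁ ≤ x → ∀ C : ClassGroup (𝓞 K),
          ‖(NumberField.classNumber K : ℂ) *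
              (smoothedPsiClass K C (tzTest (Real.log x) (x ^ (-ν))) : ℂ) -
            fordLaplace (tzTest (Real.log x) (x ^ (-ν))) (-1)‖ ≤
            A * x * (Real.exp (-(κ * Real.log x / Real.log (ThornerZaman.condQn K))) +
              Real.exp (-Real.sqrt (κ * Real.log x)))) ∧
      (∀ (ψ₁ : AddChar (Additive (ClassGroup (𝓞 K))) ℂ) (ρ₁ : ℂ), famF K ψ₁ ρ₁ = 0 → 0 < ρ₁.re →
          ρ₁.re < 1 → excRegion c K ρ₁ →
        ρ₁ = ((ρ₁.re : ℝ) : ℂ) ∧ (toMulHom ψ₁).toHomUnits * (toMulHom ψ₁).toHomUnits = 1 ∧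
        ∀ x : ℝ, ThornerZaman.condQn K ^ a₁ ≤ x → ∀ C : ClassGroup (𝓞 K),
          ‖(NumberField.classNumber K : ℂ) *
                (smoothedPsiClass K C (tzTest (Real.log x) (x ^ (-ν))) : ℂ) -
              fordLaplace (tzTest (Real.log x) (x ^ (-ν))) (-1) +
              ψ₁ (Additive.ofMul C⁻¹) * fordLaplace (tzTest (Real.log x) (x ^ (-ν))) (-(ρ₁.re : ℂ))‖ ≤
            A * x * (Real.exp (-(κ * Real.log x / Real.log (ThornerZaman.condQn K))) +
              Real.exp (-Real.sqrt (κ * Real.log x))) * min 1 ((1 - ρ₁.re) * Real.log x)) := by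
  classical
  obtain ⟨ν, aC, A₀, AJ, hν0, hν64, haC32, hA₀, hAJ0, hcoreK⟩ := smoothedClassSum_decay_core n hn hb hD ha
  obtain ⟨c₀, hc₀, hpack⟩ := exists_exceptionalZero_const n
  obtain ⟨C, hC, hDH'⟩ := hDH
  obtain ⟨c₁, hc₁, hc₁1, heff⟩ := Residue.one_sub_realZero_ge_condQn_rpow n hn
  have hn2 : (2 : ℝ) ≤ n := by exact_mod_cast hn
  have hn0 : (0 : ℝ) < n := by linarith
  set c : ℝ := min c₀ (1 / (8 * ((n : ℝ) ^ 2 + 1))) with hcdef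
  have hc : 0 < c := lt_min hc₀ (by positivity)
  have hcc₀ : c ≤ c₀ := min_le_left _ _
  have hcn : c ≤ 1 / (8 * ((n : ℝ) ^ 2 + 1)) := min_le_right _ _
  -- the regime threshold (no longer depending on a target accuracy)
  set cu : ℝ := min 1 (1 / (6 * C * n)) with hcu
  have hcu0 : 0 < cu := lt_min one_pos (by positivity)
  have hcu1 : cu ≤ 1 := min_le_left _ _
  have hcuC : cu ≤ 1 / (6 * C * n) := min_le_right _ _
  -- the decay rate and the constant
  set κ : ℝ := min (c / (4 * a)) (min (ν / 4) (1 / (32 * a * (C * n + 1)))) with hκdef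
  have hκ0 : 0 < κ := lt_min (by positivity) (lt_min (by positivity) (by positivity))
  have hκc : κ ≤ c / (4 * a) := min_le_left _ _
  have hκν : κ ≤ ν / 4 := (min_le_right _ _).trans (min_le_left _ _)
  have hκDH : κ ≤ 1 / (32 * a * (C * n + 1)) := (min_le_right _ _).trans (min_le_right _ _)
  set A : ℝ := (A₀ + AJ) / cu + ((6 * C * n + 1) * A₀ + AJ) with hAdef
  have hA0 : 0 < A := by positivity
  have hAcu : (A₀ + AJ) / cu ≤ A := by
    have : 0 ≤ (6 * C * n + 1) * A₀ + AJ := by positivity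
    linarith
  have hA1 : A₀ + AJ ≤ A := by
    refine le_trans ?_ hAcu
    rw [le_div_iff₀ hcu0]
    have : (A₀ + AJ) * cu ≤ (A₀ + AJ) * 1 := mul_le_mul_of_nonneg_left hcu1 (by positivity)
    linarith
  have hA2 : (6 * C * n + 1) * A₀ + AJ ≤ A := by
    have : 0 ≤ (A₀ + AJ) / cu := by positivity
    linarith
  -- thresholds
  set ΛJ : ℝ := (8 + 4 * max 0 (Real.log (1 / c₁))) / ν with hΛJ
  set Λ₁ : ℝ := 8 * a * C * n with hΛ₁
  set Λ₂ : ℝ := 32 * C * n + 16 * C * n * max 0 (Real.log (1 / (2 * C * n * c₁))) with hΛ₂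
  set Λ₃ : ℝ := 32 * (2 + max 0 (Real.log (1 / c₁))) ^ 2 with hΛ₃
  set a₁ : ℝ := max (max aC ΛJ) (max (max Λ₁ Λ₂) Λ₃) with ha₁
  have ha₁aC : aC ≤ a₁ := le_trans (le_max_left _ _) (le_max_left _ _)
  have ha₁32 : (32 : ℝ) ≤ a₁ := haC32.trans ha₁aC
  have ha₁J : ΛJ ≤ a₁ := le_trans (le_max_right _ _) (le_max_left _ _)
  have ha₁1' : Λ₁ ≤ a₁ := le_trans (le_trans (le_max_left _ _) (le_max_left _ _)) (le_max_right _ _)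
  have ha₁2' : Λ₂ ≤ a₁ := le_trans (le_trans (le_max_right _ _) (le_max_left _ _)) (le_max_right _ _)
  have ha₁3' : Λ₃ ≤ a₁ := le_trans (le_max_right _ _) (le_max_right _ _)
  have ha₁1 : (1 : ℝ) ≤ a₁ := by linarith
  refine ⟨ν, a₁, c, κ, A, hν0, hν64, ha₁1, hc, hcn, hκ0, hA0, fun K _ _ hKn hdens ↦ ?_⟩
  have hK : 1 < Module.finrank ℚ K := by rw [hKn]; exact hn
  set Q : ℝ := ThornerZaman.condQn K with hQ
  have hQ12 : (12 : ℝ) ≤ Q := ThornerZaman.twelve_le_condQn (K := K) hK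
  have hQ1 : (1 : ℝ) < Q := by linarith
  have hQ0 : (0 : ℝ) < Q := by linarith
  have hlogQ : 2 ≤ Real.log Q := two_lt_log_twelve.le.trans (Real.log_le_log (by norm_num) hQ12)
  have hlogQ0 : 0 < Real.log Q := by linarith
  have hlogQ1 : 1 ≤ Real.log Q := by linarith
  have hhQ : (NumberField.classNumber K : ℝ) ≤ Q ^ 4 := by
    have := ThornerZaman.classNumber_le_condQn_pow (K := K) hK; rw [← hQ] at this; exact this
  have hQm2 : Q ^ (-(2 : ℝ)) ≤ 1 := Real.rpow_le_one_of_one_le_of_nonpos hQ1.le (by norm_num)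
  have hQm2' : 0 < Q ^ (-(2 : ℝ)) := Real.rpow_pos_of_pos hQ0 _
  have hQexp2 : Q ^ (-(2 : ℝ)) = Real.exp (-(2 * Real.log Q)) := by
    rw [Real.rpow_def_of_pos hQ0]; ring_nf
  have hm'1 : c₁ * Q ^ (-(2 : ℝ)) ≤ 1 := (mul_le_mul hc₁1 hQm2 hQm2'.le zero_le_one).trans (by norm_num)
  have hm'0 : 0 < c₁ * Q ^ (-(2 : ℝ)) := mul_pos hc₁ hQm2'
  obtain ⟨hLPreal, hLPuniq, hLPsimple⟩ := hpack K hKn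
  have hzfr_c : ∀ (x : ℝ) (ψ : AddChar (Additive (ClassGroup (𝓞 K))) ℂ) (ρ : ℂ), famF K ψ ρ = 0 →
      1 / 4 ≤ ρ.re → ρ.re < 1 → |ρ.im| ≤ x → ¬ excRegion c K ρ →
        ρ.re ≤ 1 - c / (a * Real.log (ThornerZaman.condQn K) + Real.log (|ρ.im| + 4)) :=
    fun x ψ ρ h0 _ _ _ hexc ↦ zfr_classical_Qform hc hcc₀ ha hLPreal ψ h0 hexc
  -- the core estimate: zero sum with zero-free constant `cZ` plus the junk term `AJ x^{1-ν}`
  have hcore : ∀ x : ℝ, Q ^ a₁ ≤ x → ∀ (Cl : ClassGroup (𝓞 K))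
      (Exc : AddChar (Additive (ClassGroup (𝓞 K))) ℂ → Finset ℂ),
      (∀ ψ, ∀ ρ ∈ Exc ψ, famF K ψ ρ = 0 ∧ 0 < ρ.re ∧ ρ.re < 1) →
      (∀ ψ ρ, famF K ψ ρ = 0 → 0 < ρ.re → ρ.re < 1 → excRegion c K ρ → ρ ∈ Exc ψ) →
      ∀ cZ : ℝ, 0 < cZ →
      (∀ (ψ : AddChar (Additive (ClassGroup (𝓞 K))) ℂ) (ρ : ℂ), famF K ψ ρ = 0 → 1 / 4 ≤ ρ.re →
        ρ.re < 1 → |ρ.im| ≤ x → ¬ excRegion c K ρ →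
          ρ.re ≤ 1 - cZ / (a * Real.log (ThornerZaman.condQn K) + Real.log (|ρ.im| + 4))) →
      ‖(NumberField.classNumber K : ℂ) * (smoothedPsiClass K Cl (tzTest (Real.log x) (x ^ (-ν))) : ℂ) -
          fordLaplace (tzTest (Real.log x) (x ^ (-ν))) (-1) +
          ∑ ψ : AddChar (Additive (ClassGroup (𝓞 K))) ℂ, ψ (Additive.ofMul Cl⁻¹) *
            ∑ ρ ∈ Exc ψ, (famMult K ψ ρ : ℂ) * fordLaplace (tzTest (Real.log x) (x ^ (-ν))) (-ρ)‖ ≤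
        x * (A₀ * (Real.exp (-(cZ * Real.log x / (4 * a * Real.log Q))) +
          Real.exp (-Real.sqrt (cZ * Real.log x / 4)))) +
          AJ * (x * Real.exp (-(ν / 4 * Real.log x)) * (c₁ * Q ^ (-(2 : ℝ)))) := by
    intro x hx Cl Exc hExc hExc' cZ hcZ hzfr
    have hxaC : Q ^ aC ≤ x := le_trans (Real.rpow_le_rpow_of_exponent_le hQ1.le ha₁aC) hx
    have key := hcoreK K hKn hdens c x hxaC Cl Exc hExc hExc' cZ hcZ hzfr
    have hdec : x ^ (1 - ν) ≤ x * Real.exp (-(ν / 4 * Real.log x)) * (c₁ * Q ^ (-(2 : ℝ))) :=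
      rpow_one_sub_decay (a := a₁) hQ12 hx hν0 (by linarith) hc₁ (by rw [← hΛJ]; exact ha₁J)
    have := mul_le_mul_of_nonneg_left hdec hAJ0.le
    rw [← hQ] at key
    linarith
  -- common sizes at `x ≥ Q^{a₁}`
  have hsz : ∀ x : ℝ, Q ^ a₁ ≤ x → 1 < x ∧ a₁ * Real.log Q ≤ Real.log x ∧ 64 ≤ Real.log x := by
    intro x hx
    have hxQ : Q ≤ x := by
      have : Q ^ (1 : ℝ) ≤ Q ^ a₁ := Real.rpow_le_rpow_of_exponent_le hQ1.le ha₁1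
      rw [Real.rpow_one] at this; linarith
    have hx1 : 1 < x := by linarith
    have hLQ : a₁ * Real.log Q ≤ Real.log x := by
      have := Real.log_le_log (by positivity) hx
      rwa [Real.log_rpow (by linarith)] at this
    exact ⟨hx1, hLQ, by nlinarith⟩
  -- notation for the decay shape at rate `κ'`
  have hDmono : ∀ {κ' : ℝ} (x : ℝ), 1 < x → κ ≤ κ' →
      Real.exp (-(κ' * Real.log x / Real.log Q)) + Real.exp (-Real.sqrt (κ' * Real.log x)) ≤
        Real.exp (-(κ * Real.log x / Real.log Q)) + Real.exp (-Real.sqrt (κ * Real.log x)) :=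
    fun x hx1 hκ' ↦ decayShape_mono (Real.log_pos hx1).le hlogQ0 hκ'
  -- the classical zero-sum term and the junk term are below `x 𝓓_κ`
  have hclass : ∀ x : ℝ, 1 < x →
      x * (A₀ * (Real.exp (-(c * Real.log x / (4 * a * Real.log Q))) +
        Real.exp (-Real.sqrt (c * Real.log x / 4)))) ≤
        A₀ * x * (Real.exp (-(κ * Real.log x / Real.log Q)) + Real.exp (-Real.sqrt (κ * Real.log x))) := by
    intro x hx1
    have h := zeroSum_classical_decay hc.le ha (Real.log_pos hx1).le hlogQ0 hκc
    have hx0 : (0 : ℝ) ≤ x := by linarith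
    calc x * (A₀ * (Real.exp (-(c * Real.log x / (4 * a * Real.log Q))) +
          Real.exp (-Real.sqrt (c * Real.log x / 4))))
        = A₀ * x * (Real.exp (-(c * Real.log x / (4 * a * Real.log Q))) +
          Real.exp (-Real.sqrt (c * Real.log x / 4))) := by ring
      _ ≤ _ := mul_le_mul_of_nonneg_left h (by positivity)
  have hjunkD : ∀ x : ℝ, 1 < x →
      x * Real.exp (-(ν / 4 * Real.log x)) ≤
        x * (Real.exp (-(κ * Real.log x / Real.log Q)) + Real.exp (-Real.sqrt (κ * Real.log x))) := by
    intro x hx1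
    have hL0 : 0 ≤ Real.log x := (Real.log_pos hx1).le
    have h1 : Real.exp (-(ν / 4 * Real.log x)) ≤
        Real.exp (-(ν / 4 * Real.log x / Real.log Q)) + Real.exp (-Real.sqrt (ν / 4 * Real.log x)) :=
      exp_neg_mul_le_decayShape (by positivity) hL0 hlogQ1
    exact mul_le_mul_of_nonneg_left (h1.trans (hDmono x hx1 hκν)) (by linarith)
  refine ⟨?_, ?_⟩
  · -- (A) no exceptional zero
    intro hnoexc x hx Cl
    obtain ⟨hx1, hLQ, hL64⟩ := hsz x hx
    have hx0 : 0 < x := by linarith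
    have key := hcore x hx Cl (fun _ ↦ ∅) (fun ψ ρ hρ ↦ by simp at hρ)
      (fun ψ ρ h0 h1 h2 hexc ↦ absurd hexc (hnoexc ψ ρ h0 h1 h2)) c hc (hzfr_c x)
    simp only [Finset.sum_empty, mul_zero, Finset.sum_const_zero, add_zero] at key
    have h1 := hclass x hx1
    have h2 : AJ * (x * Real.exp (-(ν / 4 * Real.log x)) * (c₁ * Q ^ (-(2 : ℝ)))) ≤
        AJ * x * (Real.exp (-(κ * Real.log x / Real.log Q)) + Real.exp (-Real.sqrt (κ * Real.log x))) := by
      have h3 : x * Real.exp (-(ν / 4 * Real.log x)) * (c₁ * Q ^ (-(2 : ℝ))) ≤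
          x * Real.exp (-(ν / 4 * Real.log x)) * 1 :=
        mul_le_mul_of_nonneg_left hm'1 (by positivity)
      rw [mul_one] at h3
      have := mul_le_mul_of_nonneg_left (h3.trans (hjunkD x hx1)) hAJ0.le
      linarith
    have hD0 : 0 ≤ x * (Real.exp (-(κ * Real.log x / Real.log Q)) + Real.exp (-Real.sqrt (κ * Real.log x))) := by
      positivity
    have h4 : (A₀ + AJ) * (x * (Real.exp (-(κ * Real.log x / Real.log Q)) +
        Real.exp (-Real.sqrt (κ * Real.log x)))) ≤
        A * (x * (Real.exp (-(κ * Real.log x / Real.log Q)) + Real.exp (-Real.sqrt (κ * Real.log x)))) :=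
      mul_le_mul_of_nonneg_right hA1 hD0
    linarith [key, h1, h2, h4]
  · -- (B) an exceptional zero `(ψ₁, ρ₁)`: real, unique, simple
    intro ψ₁ ρ₁ h0₁ hre₁ hre₁' hexc₁
    obtain ⟨hρ₁, hreal₁, hmult, hβhalf, hLzero, hexcβ⟩ :=
      exceptionalZero_facts (K := K) hn hcc₀ hcn hLPreal hLPsimple ψ₁ h0₁ hre₁' hexc₁
    set β₁ : ℝ := ρ₁.re with hβ₁
    set χ₁ : ClassGroup (𝓞 K) →* ℂˣ := (toMulHom ψ₁).toHomUnits with hχ₁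
    have hβ1 : β₁ < 1 := hre₁'
    have hβ0 : 0 < β₁ := by linarith
    have hδlow : c₁ * Q ^ (-(2 : ℝ)) ≤ 1 - β₁ := heff K hKn χ₁ hreal₁ β₁ hβ1 hLzero
    have hrep := hDH' K χ₁ hreal₁ β₁ hβ0 hβ1 hLzero
    refine ⟨hρ₁, hreal₁, fun x hx Cl ↦ ?_⟩
    obtain ⟨hExc, hExc', hsumΦ⟩ := excUpdate_spec (K := K) hcc₀ hLPuniq ψ₁ h0₁ hre₁ hre₁' hexc₁ hmult
    set Exc : AddChar (Additive (ClassGroup (𝓞 K))) ℂ → Finset ℂ :=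
      Function.update (fun _ ↦ (∅ : Finset ℂ)) ψ₁ {ρ₁} with hExcdef
    have hsum : ∑ ψ : AddChar (Additive (ClassGroup (𝓞 K))) ℂ, ψ (Additive.ofMul Cl⁻¹) *
        ∑ ρ ∈ Exc ψ, (famMult K ψ ρ : ℂ) * fordLaplace (tzTest (Real.log x) (x ^ (-ν))) (-ρ) =
        ψ₁ (Additive.ofMul Cl⁻¹) * fordLaplace (tzTest (Real.log x) (x ^ (-ν))) (-(β₁ : ℂ)) := by
      have h := hsumΦ Cl (fun ρ ↦ fordLaplace (tzTest (Real.log x) (x ^ (-ν))) (-ρ))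
      rw [h, ← hρ₁]
    obtain ⟨hx1, hLQ, hL64⟩ := hsz x hx
    have hx0 : 0 < x := by linarith
    have hxQ : Q ≤ x := by
      have : Q ^ (1 : ℝ) ≤ Q ^ a₁ := Real.rpow_le_rpow_of_exponent_le hQ1.le ha₁1
      rw [Real.rpow_one] at this; linarith
    have hL1 : 1 ≤ Real.log x := by linarith
    have hL0 : 0 < Real.log x := by linarith
    have hL4 : 4 ≤ Real.log x := by linarith
    have hδ₁0 : 0 < 1 - β₁ := by linarith
    have hη₁0 : 0 < (1 - β₁) * Real.log x := mul_pos hδ₁0 hL0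
    have hδη : 1 - β₁ ≤ (1 - β₁) * Real.log x := by
      have := mul_le_mul_of_nonneg_left hL1 hδ₁0.le; rw [mul_one] at this; exact this
    have hη₁low : c₁ * Q ^ (-(2 : ℝ)) ≤ (1 - β₁) * Real.log x := hδlow.trans hδη
    have hη₁m : c₁ * Q ^ (-(2 : ℝ)) ≤ min 1 ((1 - β₁) * Real.log x) := le_min hm'1 hη₁low
    have hm0 : 0 ≤ min 1 ((1 - β₁) * Real.log x) := le_min zero_le_one hη₁0.le
    -- the decay shape at `x`
    set Dκ : ℝ := Real.exp (-(κ * Real.log x / Real.log Q)) + Real.exp (-Real.sqrt (κ * Real.log x)) with hDκ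
    have hDκ0 : 0 < Dκ := by positivity
    have hAxD : 0 ≤ A * x * Dκ * min 1 ((1 - β₁) * Real.log x) := by positivity
    -- the junk term is `≤ AJ x 𝓓_κ · min(1, (1-β₁) log x)`
    have hjunkm : AJ * (x * Real.exp (-(ν / 4 * Real.log x)) * (c₁ * Q ^ (-(2 : ℝ)))) ≤
        AJ * x * Dκ * min 1 ((1 - β₁) * Real.log x) := by
      have h1 := hjunkD x hx1
      have h2 : x * Real.exp (-(ν / 4 * Real.log x)) * (c₁ * Q ^ (-(2 : ℝ))) ≤
          x * Dκ * min 1 ((1 - β₁) * Real.log x) :=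
        mul_le_mul h1 hη₁m hm'0.le (by positivity)
      have := mul_le_mul_of_nonneg_left h2 hAJ0.le
      linarith
    rcases le_or_gt cu ((1 - β₁) * Real.log x) with hA' | hB'
    · -- regime A: `(1 − β₁) log x ≥ cu` — the classical zero-free region suffices
      have key := hcore x hx Cl Exc hExc hExc' c hc (hzfr_c x)
      rw [hsum] at key
      have hmcu : cu ≤ min 1 ((1 - β₁) * Real.log x) := le_min hcu1 hA'
      have h1 := hclass x hx1
      -- `A₀ x 𝓓 ≤ (A₀/cu) x 𝓓 min`, `AJ x 𝓓 min ≤ …`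
      have h2 : A₀ * x * Dκ ≤ A₀ / cu * x * Dκ * min 1 ((1 - β₁) * Real.log x) := by
        have e : A₀ * x * Dκ = A₀ / cu * x * Dκ * cu := by field_simp
        rw [e]
        exact mul_le_mul_of_nonneg_left hmcu (by positivity)
      have h3 : A₀ / cu * x * Dκ * min 1 ((1 - β₁) * Real.log x) + AJ * x * Dκ * min 1 ((1 - β₁) * Real.log x)
          ≤ A * x * Dκ * min 1 ((1 - β₁) * Real.log x) := by
        have hAJcu : AJ ≤ AJ / cu := by
          rw [le_div_iff₀ hcu0]
          have : AJ * cu ≤ AJ * 1 := mul_le_mul_of_nonneg_left hcu1 hAJ0.le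
          linarith
        have e : A₀ / cu * x * Dκ * min 1 ((1 - β₁) * Real.log x) +
            AJ * x * Dκ * min 1 ((1 - β₁) * Real.log x) =
            (A₀ / cu + AJ) * (x * Dκ * min 1 ((1 - β₁) * Real.log x)) := by ring
        rw [e, show A * x * Dκ * min 1 ((1 - β₁) * Real.log x) =
          A * (x * Dκ * min 1 ((1 - β₁) * Real.log x)) by ring]
        refine mul_le_mul_of_nonneg_right ?_ (by positivity)
        have : A₀ / cu + AJ / cu = (A₀ + AJ) / cu := by field_simp
        linarith
      rw [hDκ] at h2 h3 hjunkm
      linarith [key, h1, h2, h3, hjunkm]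
    · -- regime B: `(1 − β₁) log x < cu` — the Deuring–Heilbronn zero-free region
      have hη₁1 : (1 - β₁) * Real.log x ≤ 1 := hB'.le.trans hcu1
      have hmin : min 1 ((1 - β₁) * Real.log x) = (1 - β₁) * Real.log x := min_eq_right hη₁1
      have hsmall : 2 * C * n * ((1 - β₁) * Real.log x) ≤ 1 / 3 := by
        have h1 : 2 * C * n * ((1 - β₁) * Real.log x) ≤ 2 * C * n * cu :=
          mul_le_mul_of_nonneg_left hB'.le (by positivity)
        have h2 : 2 * C * n * cu ≤ 2 * C * n * (1 / (6 * C * n)) :=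
          mul_le_mul_of_nonneg_left hcuC (by positivity)
        have h3 : 2 * C * n * (1 / (6 * C * n)) = 1 / 3 := by field_simp; ring
        linarith
      have hcZ0 : 0 < min (Real.log (1 / (2 * C * n * ((1 - β₁) * Real.log x))) / (C * n))
          (a * Real.log Q / 2) := by
        refine lt_min (div_pos (Real.log_pos ?_) (by positivity)) (by positivity)
        have h0 : 0 < 2 * C * n * ((1 - β₁) * Real.log x) := by positivity
        rw [lt_div_iff₀ h0]; linarith
      have hzfr : ∀ (ψ : AddChar (Additive (ClassGroup (𝓞 K))) ℂ) (ρ : ℂ), famF K ψ ρ = 0 →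
          1 / 4 ≤ ρ.re → ρ.re < 1 → |ρ.im| ≤ x → ¬ excRegion c K ρ →
            ρ.re ≤ 1 - min (Real.log (1 / (2 * C * n * ((1 - β₁) * Real.log x))) / (C * n))
              (a * Real.log Q / 2) / (a * Real.log Q + Real.log (|ρ.im| + 4)) :=
        zfr_of_zeroRepulsion (K := K) hn hKn hC (c := c) (a := a) ha hexcβ hβ1 hxQ hL4 hrep hsmall
      have key := hcore x hx Cl Exc hExc hExc' _ hcZ0 hzfr
      rw [hsum] at key
      have hη₁low' : c₁ * Real.exp (-(2 * Real.log Q)) ≤ (1 - β₁) * Real.log x := by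
        rw [← hQexp2]; exact hη₁low
      have hzs := dhRegime_zeroSum_decay (A₀ := A₀) (C := C) (n := (n : ℝ))
        (η₁ := (1 - β₁) * Real.log x) (c₁ := c₁) (a := a) (lQ := Real.log Q) (L := Real.log x) (a₁ := a₁)
        hA₀ hC hn2 hc₁ ha hlogQ1 hη₁0 hη₁low' hsmall hLQ
        (by rw [← hΛ₁]; exact ha₁1') (by rw [← hΛ₂]; exact ha₁2') (by rw [← hΛ₃]; exact ha₁3')
      -- the Deuring–Heilbronn decay rate is `≥ κ`
      have hDH_D := hDmono x hx1 hκDH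
      have h1 : x * (A₀ * (Real.exp (-(min (Real.log (1 / (2 * C * n * ((1 - β₁) * Real.log x))) / (C * n))
          (a * Real.log Q / 2) * Real.log x / (4 * a * Real.log Q))) +
          Real.exp (-Real.sqrt (min (Real.log (1 / (2 * C * n * ((1 - β₁) * Real.log x))) / (C * n))
          (a * Real.log Q / 2) * Real.log x / 4)))) ≤
          (6 * C * n + 1) * A₀ * x * Dκ * ((1 - β₁) * Real.log x) := by
        have h2 := mul_le_mul_of_nonneg_left hzs hx0.le
        refine h2.trans ?_
        have h3 : (6 * C * n + 1) * A₀ * ((1 - β₁) * Real.log x) *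
            (Real.exp (-(1 / (32 * a * (C * n + 1)) * Real.log x / Real.log Q)) +
              Real.exp (-Real.sqrt (1 / (32 * a * (C * n + 1)) * Real.log x))) ≤
            (6 * C * n + 1) * A₀ * ((1 - β₁) * Real.log x) * Dκ :=
          mul_le_mul_of_nonneg_left hDH_D (by positivity)
        have := mul_le_mul_of_nonneg_left h3 hx0.le
        have e : x * ((6 * C * n + 1) * A₀ * ((1 - β₁) * Real.log x) * Dκ) =
            (6 * C * n + 1) * A₀ * x * Dκ * ((1 - β₁) * Real.log x) := by ring
        linarith
      have h3 : (6 * C * n + 1) * A₀ * x * Dκ * ((1 - β₁) * Real.log x) +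
          AJ * x * Dκ * ((1 - β₁) * Real.log x) ≤ A * x * Dκ * ((1 - β₁) * Real.log x) := by
        have e : (6 * C * n + 1) * A₀ * x * Dκ * ((1 - β₁) * Real.log x) +
            AJ * x * Dκ * ((1 - β₁) * Real.log x) =
            ((6 * C * n + 1) * A₀ + AJ) * (x * Dκ * ((1 - β₁) * Real.log x)) := by ring
        rw [e, show A * x * Dκ * ((1 - β₁) * Real.log x) = A * (x * Dκ * ((1 - β₁) * Real.log x)) by ring]
        exact mul_le_mul_of_nonneg_right hA2 (by positivity)
      rw [hmin] at hjunkm ⊢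
      rw [hDκ] at h1 h3 hjunkm
      linarith [key, h1, h3, hjunkm]

end Literature.NumberTheory.LFunctions.NumberField.ClassPNT

end Part2

/-!
## Part 3 — port of `Summits/QuantumAdvantage/QuantumAdvantage/Theorems/LinnikCubicClassGroupsDegreeOnePrimesEscapePerCharacterDeficitUnsmoothing.lean` (3 declarations kept)

# Unsmoothing a SIGNED character sum with trivial short-interval bounds

For a class group character `χ` of a number field `K`, `t > 1`, `ε > 0` and the Thorner–Zaman
weight `g_t = tzTest (log t) ε` the signed Chebyshev sum `T(t) = Σ_C Re χ(C) θ_C(t)` and the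
smoothed character sum `Re K_χ(g_t) = Re Σ_n Λ_χ(n) g_t(log n) = Σ_C Re χ(C) ψ̃_C(g_t)`
(`re_coefFordK_cgCoef_eq_sum`) differ by at most

  `ψ_K(√t) + (ψ_K(t e^ε) − ψ_K(t)) + (ψ_K(t) − θ_K(t))`

(`abs_thetaChar_sub_re_coefFordK_le`; class by class `θ_C ≤ ψ_C ≤ ψ̃_C(g_t) + ψ_C(√t)` and
`ψ̃_C(g_t) ≤ ψ_C(te^ε)`, summed with `|Re χ(C)| ≤ 1`), and this is at most
`n_K (log t + 1)(8√t + 2εt + 1)` for `0 < ε ≤ 1` (`unsmoothing_error_le`,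
`thetaChar_le_re_coefFordK_add`): TRIVIAL
bounds for the prime powers in `(t, te^ε]`, no Brun–Titchmarsh.
-/

section Part3

open _root_.Complex _root_.Real _root_.Finset
open scoped _root_.NumberField nonZeroDivisors
open Literature.NumberTheory.LFunctions Literature.NumberTheory.LFunctions.NumberField
  Literature.NumberTheory.LFunctions.TZWeight

namespace Literature.NumberTheory.LFunctions.NumberField.ClassPNT

variable {K : Type} [Field K] [NumberField K]

/-! ### The smoothed character sum through the smoothed class sums -/

/-- **Prime powers in a short interval, trivially**: `ψ_K(y) − ψ_K(t) ≤ n_K (y − t + 1) log y` for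
`1 ≤ t ≤ y` (`Λ_K(m) ≤ n_K Λ(m) ≤ n_K log m ≤ n_K log y` for the `≤ y − t + 1` integers
`m ∈ (t, y]`). [cite: ThornerZaman2019, Lemma 2.1 and §5 (unsmoothing with trivial short-interval bounds)] -/
theorem chebyshevPsiIdeal_sub_le {t y : ℝ} (ht : 1 ≤ t) (hty : t ≤ y) :
    chebyshevPsiIdeal K y - chebyshevPsiIdeal K t ≤ Module.finrank ℚ K * ((y - t + 1) * Real.log y) := by
  have hy0 : 0 ≤ y := by linarith
  have hsub : Icc 0 ⌊t⌋₊ ⊆ Icc 0 ⌊y⌋₊ := Icc_subset_Icc le_rfl (Nat.floor_le_floor hty)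
  rw [chebyshevPsiIdeal, chebyshevPsiIdeal, ← Finset.sum_sdiff hsub, add_sub_cancel_right]
  have hdiff : Icc 0 ⌊y⌋₊ \ Icc 0 ⌊t⌋₊ = Finset.Ioc ⌊t⌋₊ ⌊y⌋₊ := by
    ext m; simp only [Finset.mem_sdiff, Finset.mem_Icc, Finset.mem_Ioc]; omega
  rw [hdiff]
  have hterm : ∀ m ∈ Finset.Ioc ⌊t⌋₊ ⌊y⌋₊, vonMangoldtIdeal K m ≤ Module.finrank ℚ K * Real.log y := by
    intro m hm
    rw [Finset.mem_Ioc] at hm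
    have hm0 : 0 < m := by omega
    have hmy : (m : ℝ) ≤ y := (Nat.cast_le.2 hm.2).trans (Nat.floor_le hy0)
    refine (vonMangoldtIdeal_le_finrank_mul_vonMangoldt K m).trans ?_
    refine mul_le_mul_of_nonneg_left ?_ (Nat.cast_nonneg _)
    exact ArithmeticFunction.vonMangoldt_le_log.trans (Real.log_le_log (by exact_mod_cast hm0) hmy)
  refine (Finset.sum_le_sum hterm).trans ?_
  rw [Finset.sum_const, nsmul_eq_mul, Nat.card_Ioc]
  have hcard : ((⌊y⌋₊ - ⌊t⌋₊ : ℕ) : ℝ) ≤ y - t + 1 := by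
    have h1 : (⌊y⌋₊ : ℝ) ≤ y := Nat.floor_le hy0
    have h2 : t < (⌊t⌋₊ : ℝ) + 1 := Nat.lt_floor_add_one t
    have h3 : ⌊t⌋₊ ≤ ⌊y⌋₊ := Nat.floor_le_floor hty
    rw [Nat.cast_sub h3]; linarith
  have hlogy : 0 ≤ Real.log y := Real.log_nonneg (by linarith)
  have hn : (0 : ℝ) ≤ Module.finrank ℚ K := Nat.cast_nonneg _
  calc ((⌊y⌋₊ - ⌊t⌋₊ : ℕ) : ℝ) * (Module.finrank ℚ K * Real.log y)
      = Module.finrank ℚ K * (((⌊y⌋₊ - ⌊t⌋₊ : ℕ) : ℝ) * Real.log y) := by ring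
    _ ≤ Module.finrank ℚ K * ((y - t + 1) * Real.log y) :=
        mul_le_mul_of_nonneg_left (mul_le_mul_of_nonneg_right hcard hlogy) hn

/-- `ψ_K(√t) ≤ n_K (log 4 + 4) √t`.
[cite: ThornerZaman2019, Lemma 2.1 and §5 (unsmoothing with trivial short-interval bounds)] -/
theorem chebyshevPsiIdeal_sqrt_le (t : ℝ) :
    chebyshevPsiIdeal K (Real.sqrt t) ≤ Module.finrank ℚ K * ((Real.log 4 + 4) * Real.sqrt t) :=
  (chebyshevPsiIdeal_le_finrank_mul_psi K _).trans
    (mul_le_mul_of_nonneg_left (Chebyshev.psi_le_const_mul_self (Real.sqrt_nonneg t)) (Nat.cast_nonneg _))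

/-- **The unsmoothing error, explicitly**: for `t > 1` and `0 < ε ≤ 1`,
`ψ_K(√t) + (ψ_K(te^ε) − ψ_K(t)) + (ψ_K(t) − θ_K(t)) ≤ n_K (log t + 1)(8√t + 2εt + 1)`.
[cite: ThornerZaman2019, Lemma 2.1 and §5 (unsmoothing with trivial short-interval bounds)] -/
theorem unsmoothing_error_le {t ε : ℝ} (ht : 1 < t) (hε : 0 < ε) (hε1 : ε ≤ 1) :
    chebyshevPsiIdeal K (Real.sqrt t) + (chebyshevPsiIdeal K (t * Real.exp ε) - chebyshevPsiIdeal K t) +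
        (chebyshevPsiIdeal K t - chebyshevThetaIdeal K t) ≤
      Module.finrank ℚ K * ((Real.log t + 1) * (8 * Real.sqrt t + 2 * ε * t + 1)) := by
  have ht0 : 0 < t := by linarith
  have ht1 : 1 ≤ t := ht.le
  set n : ℝ := (Module.finrank ℚ K : ℝ) with hn
  have hn0 : 0 ≤ n := Nat.cast_nonneg _
  have hlogt : 0 < Real.log t := Real.log_pos ht
  have hsqrt0 : 0 ≤ Real.sqrt t := Real.sqrt_nonneg t
  -- (1) `ψ_K(√t)`
  have h1 : chebyshevPsiIdeal K (Real.sqrt t) ≤ n * (6 * Real.sqrt t) := by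
    refine (chebyshevPsiIdeal_sqrt_le t).trans (mul_le_mul_of_nonneg_left ?_ hn0)
    have hlog4 : Real.log 4 < 2 := by
      have : Real.log 4 = 2 * Real.log 2 := by
        rw [show (4:ℝ) = 2 ^ 2 by norm_num, Real.log_pow]; norm_num
      rw [this]; have := Real.log_two_lt_d9; linarith
    nlinarith
  -- (2) the short interval `(t, te^ε]`
  have hexp : t ≤ t * Real.exp ε := by have := Real.one_le_exp hε.le; nlinarith
  have h2 : chebyshevPsiIdeal K (t * Real.exp ε) - chebyshevPsiIdeal K t ≤
      n * ((2 * ε * t + 1) * (Real.log t + 1)) := by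
    refine (chebyshevPsiIdeal_sub_le ht1 hexp).trans (mul_le_mul_of_nonneg_left ?_ hn0)
    have he1 : Real.exp ε - 1 ≤ 2 * ε := by
      have := Real.abs_exp_sub_one_le (x := ε) (by rw [abs_of_pos hε]; exact hε1)
      rw [abs_of_pos hε] at this
      exact (le_abs_self _).trans this
    have hgap : t * Real.exp ε - t + 1 ≤ 2 * ε * t + 1 := by nlinarith
    have hlog : Real.log (t * Real.exp ε) ≤ Real.log t + 1 := by
      rw [Real.log_mul ht0.ne' (Real.exp_pos ε).ne', Real.log_exp]; linarith
    have hlog0 : 0 ≤ Real.log (t * Real.exp ε) := Real.log_nonneg (by nlinarith [Real.one_le_exp hε.le])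
    have hgap0 : 0 ≤ t * Real.exp ε - t + 1 := by linarith
    exact mul_le_mul hgap hlog hlog0 (by positivity)
  -- (3) the prime powers
  have h3 : chebyshevPsiIdeal K t - chebyshevThetaIdeal K t ≤ n * (2 * Real.sqrt t * Real.log t) := by
    refine (chebyshevPsiIdeal_sub_chebyshevThetaIdeal_le K ht1).trans ?_
    have h := primeIdealCount_le_two_mul_finrank_mul K hsqrt0
    rw [← hn] at h
    calc (primeIdealCount K (Real.sqrt t) : ℝ) * Real.log t ≤ (2 * n * Real.sqrt t) * Real.log t :=
          mul_le_mul_of_nonneg_right h hlogt.le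
      _ = n * (2 * Real.sqrt t * Real.log t) := by ring
  have hsum : n * (6 * Real.sqrt t) + n * ((2 * ε * t + 1) * (Real.log t + 1)) +
      n * (2 * Real.sqrt t * Real.log t) ≤ n * ((Real.log t + 1) * (8 * Real.sqrt t + 2 * ε * t + 1)) := by
    have hin : 6 * Real.sqrt t + (2 * ε * t + 1) * (Real.log t + 1) + 2 * Real.sqrt t * Real.log t ≤
        (Real.log t + 1) * (8 * Real.sqrt t + 2 * ε * t + 1) := by
      nlinarith [mul_nonneg hsqrt0 hlogt.le]
    have := mul_le_mul_of_nonneg_left hin hn0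
    linarith
  linarith

end Literature.NumberTheory.LFunctions.NumberField.ClassPNT

end Part3

/-!
## Part 4 — port of `Summits/QuantumAdvantage/QuantumAdvantage/Theorems/LinnikCubicClassGroupsDegreeOnePrimesEscapeClassPNTTheta.lean` (5 declarations kept)

# The additive class prime number theorem, V: the `θ_C`-form of the dichotomy

From the smoothed dichotomy `smoothedClassSum_dichotomy` (file IV) to the class Chebyshev functions
`θ_C(x) = Σ_{N𝔭 ≤ x, [𝔭] = C} log N𝔭`: unsmoothing class by class with TRIVIAL short-interval bounds
(`abs_theta_sub_smoothedPsiClass_le`: `|θ_C(x) − ψ̃_C(g_x)| ≤ n(log x + 1)(8√x + 2εx + 1)`, no Brun–Titchmarsh,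
the factor `h_K ≤ Q⁴` absorbed by `x ≥ Q^{a₂}`), and the main terms `F_x(−1) = x + O(√x + εx)`,
`F_x(−β) = x^β/β + O(√x + εx)` (`abs_re_fordLaplace_tzTest_neg_one_sub_le`, `abs_re_fordLaplace_tzTest_neg_sub_le`):

* `thetaClass_dichotomy` — for the number fields `K` of degree `n > 1` obeying the family density bound in
  `Q`-form and every `0 < η`: EITHER `|θ_C(x) − x/h| ≤ η x/h` for all `x ≥ Q^{a₂}` and all `C`, OR there is a
  real class group character `χ₁` with a real zero `β₁ ∈ (1 − c/(log|d_K| + log 4), 1)` of `L(s, χ₁)`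
  (`ζ_K` if `χ₁ = 1`) and `|θ_C(x) − (x − χ₁(C) x^{β₁}/β₁)/h| ≤ η x/h` for all `x ≥ Q^{a₂}`, all `C`.
-/

section Part4

open _root_.Complex _root_.Real _root_.MeasureTheory _root_.Set _root_.Filter _root_.Topology
open scoped _root_.NumberField nonZeroDivisors

namespace Literature.NumberTheory.LFunctions.NumberField.ClassPNT

open Literature.NumberTheory.LFunctions Literature.NumberTheory.LFunctions.NumberField
  Literature.NumberTheory.LFunctions.EntireEF Literature.NumberTheory.LFunctions.TZWeight
  Literature.NumberTheory.LFunctions.AbelianDensity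

/-! ### The main terms -/

/-- `e^{ε} − 1 ≤ 2ε` for `0 < ε ≤ 1`.
[cite: ThornerZaman2019, §5 proof of Thm. 5.1 (θ_C-form of the dichotomy: unsmoothing and main terms)] -/
theorem exp_sub_one_le_two_mul {ε : ℝ} (hε : 0 < ε) (hε1 : ε ≤ 1) : Real.exp ε - 1 ≤ 2 * ε := by
  have := Real.abs_exp_sub_one_le (x := ε) (by rw [abs_of_pos hε]; exact hε1)
  rw [abs_of_pos hε] at this
  exact (le_abs_self _).trans this

/-- **`F_x(−1) = x + O(√x + εx)`**: `|Re F_x(−1) − x| ≤ √x + 2εx` for `g_x = tzTest (log x) ε`, `x > 1`,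
`0 < ε ≤ 1`, `ε < (log x)/2` (sandwich `∫_{L/2}^{L} e^u ≤ F(−1) ≤ ∫_{L/2−ε}^{L+ε} e^u`).
[cite: ThornerZaman2019, §5 proof of Thm. 5.1 (θ_C-form of the dichotomy: unsmoothing and main terms)] -/
theorem abs_re_fordLaplace_tzTest_neg_one_sub_le {x ε : ℝ} (hx : 1 < x) (hε : 0 < ε) (hε1 : ε ≤ 1)
    (hεL : ε < Real.log x / 2) :
    |(fordLaplace (tzTest (Real.log x) ε) (-1)).re - x| ≤ Real.sqrt x + 2 * ε * x := by
  have hx0 : 0 < x := by linarith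
  set L := Real.log x with hL
  have hL0 : 0 < L := Real.log_pos hx
  have h := fordLaplace_tzTest_real_mem hL0 hε hεL 1
  simp only [Complex.ofReal_one, one_mul] at h
  obtain ⟨hlo, hhi⟩ := h
  rw [integral_exp] at hlo hhi
  have hexpL : Real.exp L = x := by rw [hL, Real.exp_log hx0]
  have hexpL2 : Real.exp (L / 2) = Real.sqrt x := by
    rw [Real.sqrt_eq_rpow, Real.rpow_def_of_pos hx0, ← hL]; ring_nf
  rw [hexpL, hexpL2] at hlo
  have hup : Real.exp (L + ε) - Real.exp (L / 2 - ε) ≤ x + 2 * ε * x := by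
    have h1 : Real.exp (L + ε) = x * Real.exp ε := by rw [Real.exp_add, hexpL]
    have h2 := exp_sub_one_le_two_mul hε hε1
    have h3 := Real.exp_pos (L / 2 - ε)
    nlinarith
  have hsq := Real.sqrt_nonneg x
  rw [abs_le]; constructor <;> nlinarith

/-- **`F_x(−β) = x^β/β + O(√x + εx)`** for `1/2 ≤ β ≤ 1`: `|Re F_x(−β) − x^β/β| ≤ 2√x + 4εx`.
[cite: ThornerZaman2019, §5 proof of Thm. 5.1 (θ_C-form of the dichotomy: unsmoothing and main terms)] -/
theorem abs_re_fordLaplace_tzTest_neg_sub_le {x ε β : ℝ} (hx : 1 < x) (hε : 0 < ε) (hε1 : ε ≤ 1)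
    (hεL : ε < Real.log x / 2) (hβ : 1 / 2 ≤ β) (hβ1 : β ≤ 1) :
    |(fordLaplace (tzTest (Real.log x) ε) (-(β : ℂ))).re - x ^ β / β| ≤ 2 * Real.sqrt x + 4 * ε * x := by
  have hx0 : 0 < x := by linarith
  have hβ0 : 0 < β := by linarith
  set L := Real.log x with hL
  have hL0 : 0 < L := Real.log_pos hx
  obtain ⟨hlo, hhi⟩ := fordLaplace_tzTest_real_mem hL0 hε hεL β
  rw [TZWeight.integral_exp_mul hβ0.ne'] at hlo hhi
  have hxβ : Real.exp (β * L) = x ^ β := by rw [Real.rpow_def_of_pos hx0, ← hL]; ring_nf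
  have hxβ2 : Real.exp (β * (L / 2)) ≤ Real.sqrt x := by
    rw [Real.sqrt_eq_rpow, Real.rpow_def_of_pos hx0, ← hL]
    exact Real.exp_le_exp.2 (by nlinarith)
  have hxβ2' : 0 < Real.exp (β * (L / 2)) := Real.exp_pos _
  have hxβx : x ^ β ≤ x := by
    have := Real.rpow_le_rpow_of_exponent_le hx.le hβ1; rwa [Real.rpow_one] at this
  have hxβ0 : 0 ≤ x ^ β := Real.rpow_nonneg hx0.le _
  -- lower: `(x^β − e^{βL/2})/β ≤ Re F`, so `x^β/β − Re F ≤ e^{βL/2}/β ≤ 2√x`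
  have h1 : x ^ β / β - (fordLaplace (tzTest L ε) (-(β : ℂ))).re ≤ 2 * Real.sqrt x := by
    rw [hxβ] at hlo
    have : Real.exp (β * (L / 2)) / β ≤ 2 * Real.sqrt x := by
      rw [div_le_iff₀ hβ0]; nlinarith [Real.sqrt_nonneg x]
    have e : (x ^ β - Real.exp (β * (L / 2))) / β = x ^ β / β - Real.exp (β * (L / 2)) / β := by ring
    linarith
  -- upper: `Re F ≤ (e^{β(L+ε)} − e^{β(L/2−ε)})/β ≤ x^β e^{βε}/β`, so `Re F − x^β/β ≤ x^β (e^{βε} − 1)/β ≤ 2εx`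
  have h2 : (fordLaplace (tzTest L ε) (-(β : ℂ))).re - x ^ β / β ≤ 4 * ε * x := by
    have he1 : Real.exp (β * (L + ε)) = x ^ β * Real.exp (β * ε) := by rw [mul_add, Real.exp_add, hxβ]
    have he2 : Real.exp (β * ε) - 1 ≤ 2 * (β * ε) := by
      have hβε1 : β * ε ≤ 1 := by nlinarith
      exact exp_sub_one_le_two_mul (by positivity) hβε1
    have he3 : 0 < Real.exp (β * (L / 2 - ε)) := Real.exp_pos _
    have hup : (Real.exp (β * (L + ε)) - Real.exp (β * (L / 2 - ε))) / β ≤ x ^ β / β + 4 * ε * x := by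
      rw [div_le_iff₀ hβ0, he1]
      have : (x ^ β / β + 4 * ε * x) * β = x ^ β + 4 * ε * x * β := by field_simp
      rw [this]
      have hA : x ^ β * (Real.exp (β * ε) - 1) ≤ x ^ β * (2 * (β * ε)) := mul_le_mul_of_nonneg_left he2 hxβ0
      have hB : x ^ β * (2 * (β * ε)) ≤ x * (2 * (β * ε)) :=
        mul_le_mul_of_nonneg_right hxβx (by positivity)
      nlinarith [hA, hB, he3, mul_pos (mul_pos hβ0 hε) hx0]
    linarith
  have h4εx : 0 ≤ 4 * ε * x := by positivity
  rw [abs_le]; constructor <;> linarith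

/-! ### Unsmoothing class by class -/

/-- **`|θ_C(t) − ψ̃_C(g_t)| ≤ n_K (log t + 1)(8√t + 2εt + 1)`** for `g_t = tzTest (log t) ε`, `t > 1`,
`0 < ε ≤ 1` (class by class: `θ_C ≤ ψ_C ≤ ψ̃_C + ψ_C(√t)`, `ψ̃_C ≤ ψ_C(te^ε)`; each class error is at most
the total `ψ_K(√t) + (ψ_K(te^ε) − ψ_K(t)) + (ψ_K(t) − θ_K(t))`, bounded trivially).
[cite: ThornerZaman2019, §5 proof of Thm. 5.1 (θ_C-form of the dichotomy: unsmoothing and main terms)] -/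
theorem abs_theta_sub_smoothedPsiClass_le {K : Type} [Field K] [NumberField K] (C : ClassGroup (𝓞 K))
    {t ε : ℝ} (ht : 1 < t) (hε : 0 < ε) (hε1 : ε ≤ 1) :
    |chebyshevThetaIdealClass K C t - smoothedPsiClass K C (tzTest (Real.log t) ε)| ≤
      Module.finrank ℚ K * ((Real.log t + 1) * (8 * Real.sqrt t + 2 * ε * t + 1)) := by
  classical
  have h1 := chebyshevThetaIdealClass_le_classPsi (K := K) C t
  have h2 := classPsi_le_smoothedPsiClass_add (K := K) C ht hε
  have h3 := smoothedPsiClass_le_classPsi (K := K) C ht hε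
  have hexp : t ≤ t * Real.exp ε := by have := Real.one_le_exp hε.le; nlinarith
  have h4 : classPsi K C t ≤ classPsi K C (t * Real.exp ε) := classPsi_mono C hexp
  -- each class term is bounded by the corresponding total
  have hA : classPsi K C (Real.sqrt t) ≤ chebyshevPsiIdeal K (Real.sqrt t) := classPsi_le_chebyshevPsiIdeal C _
  have hB : classPsi K C (t * Real.exp ε) - classPsi K C t ≤
      chebyshevPsiIdeal K (t * Real.exp ε) - chebyshevPsiIdeal K t := by
    rw [← sum_classPsi (t * Real.exp ε), ← sum_classPsi t, ← Finset.sum_sub_distrib]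
    exact Finset.single_le_sum (f := fun C' ↦ classPsi K C' (t * Real.exp ε) - classPsi K C' t)
      (fun C' _ ↦ sub_nonneg.2 (classPsi_mono C' hexp)) (Finset.mem_univ C)
  have hC : classPsi K C t - chebyshevThetaIdealClass K C t ≤ chebyshevPsiIdeal K t - chebyshevThetaIdeal K t :=
    classPsi_sub_theta_le C t
  have htot := unsmoothing_error_le (K := K) ht hε hε1
  have hpos : 0 ≤ classPsi K C (Real.sqrt t) := classPsi_nonneg C _
  rw [abs_le]; constructor <;> linarith

/-! ### The `θ_C`-form of the dichotomy -/

/-- For a real class group character, `χ(C⁻¹) = χ(C)`.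
[cite: ThornerZaman2019, §5 proof of Thm. 5.1 (θ_C-form of the dichotomy: unsmoothing and main terms)] -/
theorem classGroupChar_apply_inv_of_real {K : Type} [Field K] [NumberField K] {χ : ClassGroup (𝓞 K) →* ℂˣ}
    (hχ : χ * χ = 1) (C : ClassGroup (𝓞 K)) : χ C⁻¹ = χ C := by
  have h2 : χ C * χ C = 1 := by
    have := DFunLike.congr_fun hχ C
    rwa [MonoidHom.mul_apply, MonoidHom.one_apply] at this
  have h1 : χ C⁻¹ * χ C = 1 := by rw [← map_mul, inv_mul_cancel, map_one]
  calc χ C⁻¹ = χ C⁻¹ * (χ C * χ C) := by rw [h2, mul_one]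
    _ = χ C := by rw [← mul_assoc, h1, one_mul]

end Literature.NumberTheory.LFunctions.NumberField.ClassPNT

end Part4

/-!
## Part 5 — port of `Summits/QuantumAdvantage/QuantumAdvantage/Theorems/LinnikCubicClassGroupsDegreeOnePrimesEscapeClassPNTDHThetaDecay.lean` (1 declarations kept)

# The class prime number theorem with DECAYING error, III: the `θ_C`-form

`thetaClass_decay`: the decaying-error twin of `thetaClass_dichotomy_dh` (`…ClassPNTDHTheta.lean`), obtained
from `smoothedClassSum_decay` (`…ClassPNTDHSmoothedDecay.lean`) by unsmoothing class by class.  GIVEN the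
Deuring–Heilbronn phenomenon for the class group `L`-functions (hypothesis `hDH`, the statement of
`Literature.NumberTheory.LFunctions.NumberField.deuringHeilbronn` verbatim), for the number fields `K` of one degree
`n > 1` obeying the family density bound in `Q`-form, with `𝓓_κ(x) = e^{−κ log x/log Q} + e^{−√(κ log x)}`,
`Q = |d_K| n^n`, and all `x ≥ Q^{a₂}` and classes `C`:
(A) if no zero of the family lies on the exceptional segment `excRegion c K`:
  `|θ_C(x) − x/h| ≤ A x 𝓓_κ(x)/h`;
(B) if `ρ₁ = β₁` is a zero of `F_{ψ₁}` on the segment (then real, `χ₁ = χ_{ψ₁}` real, `L(β₁, χ₁) = 0`):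
  `|θ_C(x) − (x − χ₁(C) x^{β₁}/β₁)/h| ≤ A x 𝓓_κ(x) · min(1, (1 − β₁) log x)/h`.
The unsmoothing error `n h (log x + 1)(8√x + 2x^{1−ν} + 1)` (`abs_theta_sub_smoothedPsiClass_le`) and the
main-term errors `O(√x + x^{1−ν})` are `≤ const · x e^{−(ν/4) log x} · c₁ Q^{−2}` (`unsmoothing_decay`,
`rpow_one_sub_decay`), below both `x 𝓓_κ` and `x 𝓓_κ (1 − β₁) log x` by Stark's effective bound
`c₁ Q^{−2} ≤ 1 − β₁` (`Residue.one_sub_realZero_ge_condQn_rpow`).  This is [ThornerZaman2019, Thm. 5.1 /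
Lemma 2.1] for `L = H_K`, `θ_C`-form, at a fixed degree.

References: J. Thorner, A. Zaman, Algebra Number Theory 13 (2019), Thm. 1.4, Lemma 2.1, §5 [ThornerZaman2019];
A. Weiss, J. reine angew. Math. 338 (1983), Thm. 5.2 [Weiss1983].
-/

section Part5

open _root_.Complex _root_.Real _root_.MeasureTheory _root_.Set _root_.Filter _root_.Topology
open scoped _root_.NumberField nonZeroDivisors

namespace Literature.NumberTheory.LFunctions.NumberField.ClassPNT

open Literature.NumberTheory.LFunctions Literature.NumberTheory.LFunctions.NumberField
  Literature.NumberTheory.LFunctions.EntireEF Literature.NumberTheory.LFunctions.TZWeight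
  Literature.NumberTheory.LFunctions.AbelianDensity

set_option maxHeartbeats 1600000 in
/-- **The `θ_C`-form of the class prime number theorem with the Deuring–Heilbronn phenomenon and DECAYING
error** (see the module docstring). [cite: ThornerZaman2019, Theorem 1.4 and Lemma 2.1] [cite: Weiss1983, Theorem 5.2] -/
theorem thetaClass_decay (n : ℕ) (hn : 1 < n) {b D a : ℝ} (hb : 0 < b) (hD : 0 < D) (ha : 1 ≤ a)
    (hDH : ∃ C : ℝ, 0 < C ∧ ∀ (K : Type) [Field K] [NumberField K] (χ₁ : ClassGroup (𝓞 K) →* ℂˣ),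
      χ₁ * χ₁ = 1 → ∀ β₁ : ℝ, 0 < β₁ → β₁ < 1 → classGroupLFunction K χ₁ β₁ = 0 →
      ∀ (χ : ClassGroup (𝓞 K) →* ℂˣ) (ρ : ℂ), classGroupLFunction K χ ρ = 0 → 1 / 2 ≤ ρ.re → ρ ≠ 1 →
        ρ ≠ β₁ →
        Real.log (1 / (C * (Real.log ((NumberField.discr K).natAbs : ℝ) +
            Module.finrank ℚ K * (Real.log (|ρ.im| + 2) + 1)) * (1 - β₁))) /
          (C * (Real.log ((NumberField.discr K).natAbs : ℝ) +
            Module.finrank ℚ K * (Real.log (|ρ.im| + 2) + 1))) ≤ 1 - ρ.re) :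
    ∃ a₂ c κ A : ℝ, 1 ≤ a₂ ∧ 0 < c ∧ c ≤ 1 / (8 * ((n : ℝ) ^ 2 + 1)) ∧ 0 < κ ∧ 0 < A ∧
    ∀ (K : Type) [Field K] [NumberField K], Module.finrank ℚ K = n →
      (∀ (T : ℝ), 1 ≤ T → ∀ u : AddChar (Additive (ClassGroup (𝓞 K))) ℂ → Finset ℂ,
        (∀ ψ, ∀ ρ ∈ u ψ, famF K ψ ρ = 0 ∧ 1 / 4 ≤ ρ.re ∧ ρ.re < 1 ∧ |ρ.im| ≤ T) →
        ∀ α : ℝ, α ≤ 1 →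
          ∑ ψ, ∑ ρ ∈ u ψ with α ≤ ρ.re, (famMult K ψ ρ : ℝ) ≤
            D * Real.exp (b * (a * Real.log (ThornerZaman.condQn K) + Real.log (T + 4))) ^ (1 - α)) →
      ((∀ (ψ : AddChar (Additive (ClassGroup (𝓞 K))) ℂ) (ρ : ℂ), famF K ψ ρ = 0 → 0 < ρ.re →
          ρ.re < 1 → ¬ excRegion c K ρ) →
        ∀ x : ℝ, ThornerZaman.condQn K ^ a₂ ≤ x → ∀ C : ClassGroup (𝓞 K),
          |chebyshevThetaIdealClass K C x - x / NumberField.classNumber K| ≤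
            A * x * (Real.exp (-(κ * Real.log x / Real.log (ThornerZaman.condQn K))) +
              Real.exp (-Real.sqrt (κ * Real.log x))) / NumberField.classNumber K) ∧
      (∀ (ψ₁ : AddChar (Additive (ClassGroup (𝓞 K))) ℂ) (ρ₁ : ℂ), famF K ψ₁ ρ₁ = 0 → 0 < ρ₁.re →
          ρ₁.re < 1 → excRegion c K ρ₁ →
        ρ₁ = ((ρ₁.re : ℝ) : ℂ) ∧ (toMulHom ψ₁).toHomUnits * (toMulHom ψ₁).toHomUnits = 1 ∧
        classGroupLFunction K (toMulHom ψ₁).toHomUnits ρ₁.re = 0 ∧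
        ∀ x : ℝ, ThornerZaman.condQn K ^ a₂ ≤ x → ∀ C : ClassGroup (𝓞 K),
          |chebyshevThetaIdealClass K C x -
              (x - (((toMulHom ψ₁).toHomUnits C : ℂ)).re * x ^ ρ₁.re / ρ₁.re) / NumberField.classNumber K| ≤
            A * x * (Real.exp (-(κ * Real.log x / Real.log (ThornerZaman.condQn K))) +
              Real.exp (-Real.sqrt (κ * Real.log x))) * min 1 ((1 - ρ₁.re) * Real.log x) /
              NumberField.classNumber K) := by
  classical
  obtain ⟨ν, a₁, c, κ, A, hν0, hν64, ha₁1, hc, hcn, hκ0, hA0, hmain⟩ :=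
    smoothedClassSum_decay n hn hb hD ha hDH
  obtain ⟨c₁, hc₁, hc₁1, heff⟩ := Residue.one_sub_realZero_ge_condQn_rpow n hn
  have hn2 : (2 : ℝ) ≤ n := by exact_mod_cast hn
  -- thresholds: unsmoothing and the powers `x^{1-ν}`
  set ΛU : ℝ := (24 + 4 * max 0 (Real.log (88 * ((n : ℝ) + 1) / (ν * c₁)))) / ν with hΛU
  set ΛP : ℝ := (8 + 4 * max 0 (Real.log (1 / c₁))) / ν with hΛP
  set a₂ : ℝ := max a₁ (max ΛU ΛP) with ha₂
  have ha₂a₁ : a₁ ≤ a₂ := le_max_left _ _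
  have ha₂U : ΛU ≤ a₂ := le_trans (le_max_left _ _) (le_max_right _ _)
  have ha₂P : ΛP ≤ a₂ := le_trans (le_max_right _ _) (le_max_right _ _)
  have ha₂1 : 1 ≤ a₂ := le_trans ha₁1 ha₂a₁
  have ha₂8 : 8 ≤ a₂ := by
    refine le_trans ?_ ha₂P
    rw [hΛP, le_div_iff₀ hν0]
    have : 0 ≤ max 0 (Real.log (1 / c₁)) := le_max_left _ _
    nlinarith
  set κ' : ℝ := min κ (ν / 4) with hκ'
  have hκ'0 : 0 < κ' := lt_min hκ0 (by positivity)
  have hκ'κ : κ' ≤ κ := min_le_left _ _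
  have hκ'ν : κ' ≤ ν / 4 := min_le_right _ _
  refine ⟨a₂, c, κ', A + 10, ha₂1, hc, hcn, hκ'0, by positivity, fun K _ _ hKn hdens ↦ ?_⟩
  obtain ⟨hgoodK, hexcK⟩ := hmain K hKn hdens
  have hK : 1 < Module.finrank ℚ K := by rw [hKn]; exact hn
  set Q : ℝ := ThornerZaman.condQn K with hQ
  have hQ12 : (12 : ℝ) ≤ Q := ThornerZaman.twelve_le_condQn (K := K) hK
  have hQ1 : (1 : ℝ) < Q := by linarith
  have hQ0 : (0 : ℝ) < Q := by linarith
  have hlogQ : 2 ≤ Real.log Q := two_lt_log_twelve.le.trans (Real.log_le_log (by norm_num) hQ12)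
  have hlogQ1 : 1 ≤ Real.log Q := by linarith
  have hlogQ0 : 0 < Real.log Q := by linarith
  set h : ℝ := (NumberField.classNumber K : ℝ) with hh
  have hh1 : 1 ≤ h := by rw [hh]; exact_mod_cast one_le_classNumber (K := K)
  have hh0 : 0 < h := by linarith
  have hhQ : h ≤ Q ^ 4 := by
    have := ThornerZaman.classNumber_le_condQn_pow (K := K) hK; rw [← hQ] at this; exact this
  have hQm2 : Q ^ (-(2 : ℝ)) ≤ 1 := Real.rpow_le_one_of_one_le_of_nonpos hQ1.le (by norm_num)
  have hQm2' : 0 < Q ^ (-(2 : ℝ)) := Real.rpow_pos_of_pos hQ0 _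
  set m' : ℝ := c₁ * Q ^ (-(2 : ℝ)) with hm'
  have hm'0 : 0 < m' := mul_pos hc₁ hQm2'
  have hm'1 : m' ≤ 1 := (mul_le_mul hc₁1 hQm2 hQm2'.le zero_le_one).trans (by norm_num)
  -- common estimates at `x ≥ Q^{a₂}`: the unsmoothing and main-term errors are `≤ 10 x 𝓓_{κ'} m'`
  have hcommon : ∀ x : ℝ, Q ^ a₂ ≤ x → Q ^ a₁ ≤ x ∧ 1 < x ∧
      0 < x ^ (-ν) ∧ x ^ (-ν) ≤ 1 ∧ x ^ (-ν) < Real.log x / 2 ∧ 1 ≤ Real.log x ∧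
      (Real.exp (-(κ * Real.log x / Real.log Q)) + Real.exp (-Real.sqrt (κ * Real.log x)) ≤
        Real.exp (-(κ' * Real.log x / Real.log Q)) + Real.exp (-Real.sqrt (κ' * Real.log x))) ∧
      (∀ C : ClassGroup (𝓞 K), h * |chebyshevThetaIdealClass K C x -
          smoothedPsiClass K C (tzTest (Real.log x) (x ^ (-ν)))| + 9 * x ^ (1 - ν) ≤
        10 * x * (Real.exp (-(κ' * Real.log x / Real.log Q)) + Real.exp (-Real.sqrt (κ' * Real.log x))) * m') ∧
      Real.sqrt x ≤ x ^ (1 - ν) ∧ x ^ (-ν) * x = x ^ (1 - ν) := by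
    intro x hx
    have hxa₁ : Q ^ a₁ ≤ x := le_trans (Real.rpow_le_rpow_of_exponent_le hQ1.le ha₂a₁) hx
    have hxQ : Q ≤ x := by
      have : Q ^ (1 : ℝ) ≤ Q ^ a₂ := Real.rpow_le_rpow_of_exponent_le hQ1.le ha₂1
      rw [Real.rpow_one] at this; linarith
    have hx1 : 1 < x := by linarith
    have hx0 : 0 < x := by linarith
    set L : ℝ := Real.log x with hL
    have hLQ : a₂ * Real.log Q ≤ L := by
      have := Real.log_le_log (by positivity) hx
      rwa [Real.log_rpow (by linarith)] at this
    have hL2 : 16 ≤ L := by nlinarith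
    have hL0 : 0 < L := by linarith
    set ε : ℝ := x ^ (-ν) with hε
    have hε0 : 0 < ε := Real.rpow_pos_of_pos hx0 _
    have hε1 : ε ≤ 1 := Real.rpow_le_one_of_one_le_of_nonpos hx1.le (by linarith)
    have hεL : ε < L / 2 := by linarith
    have hD := decayShape_mono (κ := κ) (κ' := κ') hL0.le hlogQ0 hκ'κ
    -- the decay of `x^{1-ν}` and of the unsmoothing error
    have hP : x ^ (1 - ν) ≤ x * Real.exp (-(ν / 4 * L)) * m' :=
      rpow_one_sub_decay (a := a₂) hQ12 hx hν0 (by linarith) hc₁ (by rw [← hΛP]; exact ha₂P)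
    have hU : ∀ C : ClassGroup (𝓞 K), h * |chebyshevThetaIdealClass K C x -
        smoothedPsiClass K C (tzTest L ε)| ≤ x * Real.exp (-(ν / 4 * L)) * m' := by
      intro C
      have h1 := abs_theta_sub_smoothedPsiClass_le C hx1 hε0 hε1
      rw [hKn] at h1
      have h2 := unsmoothing_decay (n := (n : ℝ)) (h := h) (a := a₂) (Nat.cast_nonneg n) hh0.le hhQ hQ12 hν0
        (by linarith) hc₁ hx (by rw [← hΛU]; exact ha₂U)
      have h3 := mul_le_mul_of_nonneg_left h1 hh0.le
      have e : h * ((n : ℝ) * ((Real.log x + 1) * (8 * Real.sqrt x + 2 * ε * x + 1))) =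
          (n : ℝ) * h * ((Real.log x + 1) * (8 * Real.sqrt x + 2 * x ^ (-ν) * x + 1)) := by rw [hε]; ring
      rw [e] at h3
      exact h3.trans h2
    -- `e^{-(ν/4)L} ≤ 𝓓_{κ'}`
    have hνD : Real.exp (-(ν / 4 * L)) ≤
        Real.exp (-(κ' * L / Real.log Q)) + Real.exp (-Real.sqrt (κ' * L)) :=
      (exp_neg_mul_le_decayShape (by positivity) hL0.le hlogQ1).trans
        (decayShape_mono hL0.le hlogQ0 hκ'ν)
    have hxνD : x * Real.exp (-(ν / 4 * L)) * m' ≤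
        x * (Real.exp (-(κ' * L / Real.log Q)) + Real.exp (-Real.sqrt (κ' * L))) * m' :=
      mul_le_mul_of_nonneg_right (mul_le_mul_of_nonneg_left hνD hx0.le) hm'0.le
    have hsum : ∀ C : ClassGroup (𝓞 K), h * |chebyshevThetaIdealClass K C x -
        smoothedPsiClass K C (tzTest L ε)| + 9 * x ^ (1 - ν) ≤
        10 * x * (Real.exp (-(κ' * L / Real.log Q)) + Real.exp (-Real.sqrt (κ' * L))) * m' := by
      intro C
      have h1 := (hU C).trans hxνD
      have h2 := hP.trans hxνD
      linarith
    have hsqrt : Real.sqrt x ≤ x ^ (1 - ν) := by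
      rw [Real.sqrt_eq_rpow]; exact Real.rpow_le_rpow_of_exponent_le hx1.le (by linarith)
    have hpow : x ^ (-ν) * x = x ^ (1 - ν) := by
      rw [sub_eq_add_neg, Real.rpow_add hx0, Real.rpow_one]; ring
    exact ⟨hxa₁, hx1, hε0, hε1, hεL, by linarith, hD, hsum, hsqrt, hpow⟩
  refine ⟨?_, ?_⟩
  · -- (A) no exceptional zero
    intro hnoexc x hx C
    obtain ⟨hxa₁, hx1, hε0, hε1, hεL, hL1, hD, hU9, hsqrt, hpow⟩ := hcommon x hx
    have hx0 : 0 < x := by linarith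
    set Dκ' : ℝ := Real.exp (-(κ' * Real.log x / Real.log Q)) + Real.exp (-Real.sqrt (κ' * Real.log x))
      with hDκ'
    have hDκ'0 : 0 < Dκ' := by positivity
    have h1 := hgoodK hnoexc x hxa₁ C
    have h1' := (Complex.abs_re_le_norm _).trans h1
    simp only [Complex.sub_re, Complex.mul_re, Complex.natCast_re, Complex.natCast_im,
      Complex.ofReal_re, Complex.ofReal_im, mul_zero, sub_zero] at h1'
    have h2 := abs_re_fordLaplace_tzTest_neg_one_sub_le hx1 hε0 hε1 hεL
    have h3 := hU9 C
    -- `A x 𝓓_κ ≤ A x 𝓓_{κ'}`, `10 x 𝓓 m' ≤ 10 x 𝓓`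
    have hAD : A * x * (Real.exp (-(κ * Real.log x / Real.log Q)) + Real.exp (-Real.sqrt (κ * Real.log x))) ≤
        A * x * Dκ' := mul_le_mul_of_nonneg_left hD (by positivity)
    have h10 : 10 * x * Dκ' * m' ≤ 10 * x * Dκ' := by
      have := mul_le_mul_of_nonneg_left hm'1 (by positivity : (0 : ℝ) ≤ 10 * x * Dκ'); linarith
    have hkey : |h * chebyshevThetaIdealClass K C x - x| ≤ (A + 10) * x * Dκ' := by
      have hDabs : |h * (chebyshevThetaIdealClass K C x -
          smoothedPsiClass K C (tzTest (Real.log x) (x ^ (-ν))))| ≤ 10 * x * Dκ' - 9 * x ^ (1 - ν) := by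
        rw [abs_mul, abs_of_pos hh0]; rw [hDκ'] at h10 ⊢; linarith [h3]
      have hD' := abs_le.1 hDabs
      have hεx : 2 * x ^ (-ν) * x = 2 * x ^ (1 - ν) := by rw [mul_assoc, hpow]
      rw [hεx] at h2
      rw [abs_le] at h1' h2 ⊢
      rw [← hh] at h1'
      rw [hDκ'] at hAD hD' ⊢
      have hP0 : 0 ≤ x ^ (1 - ν) := Real.rpow_nonneg hx0.le (1 - ν)
      constructor <;> linarith [hD'.1, hD'.2, h1'.1, h1'.2, h2.1, h2.2, hsqrt, hAD, hP0]
    have e : chebyshevThetaIdealClass K C x - x / h = (h * chebyshevThetaIdealClass K C x - x) / h := by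
      field_simp
    rw [e, abs_div, abs_of_pos hh0, div_le_div_iff_of_pos_right hh0]
    exact hkey
  · -- (B) the exceptional zero
    intro ψ₁ ρ₁ h0₁ hre₁ hre₁' hexc₁
    obtain ⟨hρ₁, hreal, hexcx⟩ := hexcK ψ₁ ρ₁ h0₁ hre₁ hre₁' hexc₁
    set β₁ : ℝ := ρ₁.re with hβ₁def
    set χ₁ : ClassGroup (𝓞 K) →* ℂˣ := (toMulHom ψ₁).toHomUnits with hχ₁
    have hβ1 : β₁ < 1 := hre₁'
    have hβ1ne : ((β₁ : ℝ) : ℂ) ≠ 1 := by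
      intro h'; apply hβ1.ne; exact_mod_cast h'
    have h0β : famF K ψ₁ (β₁ : ℂ) = 0 := by rw [← hρ₁]; exact h0₁
    have hLzero : classGroupLFunction K χ₁ β₁ = 0 := classGroupLFunction_eq_zero_of_famF ψ₁ h0β hβ1ne
    have hδlow : m' ≤ 1 - β₁ := heff K hKn χ₁ hreal β₁ hβ1 hLzero
    -- `β₁ ≥ 1/2`
    have hβhalf : 1 / 2 ≤ β₁ := by
      have hlog4 : 1 < Real.log 4 := by
        rw [show (4:ℝ) = 2 ^ 2 by norm_num, Real.log_pow]; have := Real.log_two_gt_d9; push_cast; linarith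
      have hlogd : 0 ≤ Real.log ((NumberField.discr K).natAbs : ℝ) := Real.log_natCast_nonneg _
      have hc2 : c ≤ 1 / 2 :=
        hcn.trans (by rw [div_le_div_iff_of_pos_left one_pos (by positivity) (by norm_num)]; nlinarith)
      have : c / (Real.log ((NumberField.discr K).natAbs : ℝ) + Real.log 4) ≤ 1 / 2 := by
        rw [div_le_iff₀ (by linarith)]; nlinarith
      have h' := hexc₁.2
      linarith
    refine ⟨hρ₁, hreal, hLzero, fun x hx C ↦ ?_⟩
    obtain ⟨hxa₁, hx1, hε0, hε1, hεL, hL1, hD, hU9, hsqrt, hpow⟩ := hcommon x hx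
    have hx0 : 0 < x := by linarith
    set Dκ' : ℝ := Real.exp (-(κ' * Real.log x / Real.log Q)) + Real.exp (-Real.sqrt (κ' * Real.log x))
      with hDκ'
    have hDκ'0 : 0 < Dκ' := by positivity
    -- `m' ≤ m = min 1 ((1 - β₁) log x)`
    set m : ℝ := min 1 ((1 - β₁) * Real.log x) with hmdef
    have hδm : 1 - β₁ ≤ (1 - β₁) * Real.log x := by
      have := mul_le_mul_of_nonneg_left hL1 (by linarith : (0 : ℝ) ≤ 1 - β₁); linarith
    have hm'm : m' ≤ m := le_min hm'1 (hδlow.trans hδm)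
    have hm0 : 0 ≤ m := hm'0.le.trans hm'm
    have h1 := hexcx x hxa₁ C
    have h1' := (Complex.abs_re_le_norm _).trans h1
    have hFreal : (fordLaplace (tzTest (Real.log x) (x ^ (-ν))) (-(β₁ : ℂ))).im = 0 := by
      rw [fordLaplace_tzTest_ofReal (Real.log_pos hx1) hε0 β₁, Complex.ofReal_im]
    have hψC : ψ₁ (Additive.ofMul C⁻¹) = (χ₁ C : ℂ) := by
      rw [← classGroupChar_apply_inv_of_real hreal C]
      exact (toHomUnits_toMulHom_apply ψ₁ C⁻¹).symm
    simp only [Complex.add_re, Complex.sub_re, Complex.mul_re, Complex.natCast_re, Complex.natCast_im,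
      Complex.ofReal_re, Complex.ofReal_im, mul_zero, sub_zero, hFreal, hψC] at h1'
    have h2 := abs_re_fordLaplace_tzTest_neg_one_sub_le hx1 hε0 hε1 hεL
    have h4 := abs_re_fordLaplace_tzTest_neg_sub_le hx1 hε0 hε1 hεL hβhalf hβ1.le
    have h3 := hU9 C
    have hχre := abs_re_classGroupChar_apply_le hreal C
    -- scale the error terms from `m'`/`𝓓_κ` to `m`/`𝓓_{κ'}`
    have hAD : A * x * (Real.exp (-(κ * Real.log x / Real.log Q)) +
        Real.exp (-Real.sqrt (κ * Real.log x))) * m ≤ A * x * Dκ' * m :=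
      mul_le_mul_of_nonneg_right (mul_le_mul_of_nonneg_left hD (by positivity)) hm0
    have h10 : 10 * x * Dκ' * m' ≤ 10 * x * Dκ' * m :=
      mul_le_mul_of_nonneg_left hm'm (by positivity)
    set mt : ℝ := x ^ β₁ / β₁ with hmtdef
    have hkey : |h * chebyshevThetaIdealClass K C x - (x - ((χ₁ C : ℂ)).re * mt)| ≤
        (A + 10) * x * Dκ' * m := by
      have hDabs : |h * (chebyshevThetaIdealClass K C x -
          smoothedPsiClass K C (tzTest (Real.log x) (x ^ (-ν))))| ≤ 10 * x * Dκ' * m - 9 * x ^ (1 - ν) := by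
        rw [abs_mul, abs_of_pos hh0]; rw [hDκ'] at h10 ⊢; linarith [h3]
      have hD' := abs_le.1 hDabs
      rw [← hh] at h1'
      set r : ℝ := ((χ₁ C : ℂ)).re with hr
      set Fβ : ℝ := (fordLaplace (tzTest (Real.log x) (x ^ (-ν))) (-(β₁ : ℂ))).re with hFβ
      have hprod : |r * Fβ - r * mt| ≤ 2 * Real.sqrt x + 4 * x ^ (-ν) * x := by
        rw [← mul_sub, abs_mul]
        calc |r| * |Fβ - mt| ≤ 1 * (2 * Real.sqrt x + 4 * x ^ (-ν) * x) :=
              mul_le_mul hχre h4 (abs_nonneg _) zero_le_one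
          _ = _ := one_mul _
      have hε2 : 2 * x ^ (-ν) * x = 2 * x ^ (1 - ν) := by rw [mul_assoc, hpow]
      have hε4 : 4 * x ^ (-ν) * x = 4 * x ^ (1 - ν) := by rw [mul_assoc, hpow]
      rw [hε2] at h2
      rw [hε4] at hprod
      have hprod' := abs_le.1 hprod
      rw [abs_le] at h1' h2 ⊢
      have hmin : min 1 ((1 - ρ₁.re) * Real.log x) = m := by rw [hmdef]
      rw [hmin] at h1'
      rw [hDκ'] at hAD hD' ⊢
      have hP0 : 0 ≤ x ^ (1 - ν) := Real.rpow_nonneg hx0.le (1 - ν)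
      constructor <;> linarith [hD'.1, hD'.2, h1'.1, h1'.2, h2.1, h2.2, hprod'.1, hprod'.2, hsqrt, hAD, hP0]
    rw [hmtdef] at hkey
    have e : chebyshevThetaIdealClass K C x - (x - ((χ₁ C : ℂ)).re * x ^ β₁ / β₁) / h =
        (h * chebyshevThetaIdealClass K C x - (x - ((χ₁ C : ℂ)).re * (x ^ β₁ / β₁))) / h := by
      field_simp
    rw [e, abs_div, abs_of_pos hh0, div_le_div_iff_of_pos_right hh0]
    exact hkey

end Literature.NumberTheory.LFunctions.NumberField.ClassPNT

end Part5

/-!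
## Part 6 — port of `Summits/QuantumAdvantage/QuantumAdvantage/Theorems/LinnikCubicClassGroupsDegreeOnePrimesEscapeClassPNTTZFormPrelims.lean` (6 declarations kept)

# The class prime number theorem with DECAYING error, IV′: small lemmas for the Thorner–Zaman form

Bookkeeping between the cell's vocabulary (the family `F_ψ`, the exceptional segment `excRegion c K`, the
decay shape `𝓓_κ(x) = e^{−κ log x/log Q} + e^{−√(κ log x)}`) and the vocabulary of the tree's named fact
`ThornerZaman2019_classPNT_imaginaryQuadratic` / `…_hilbertClassField` (`UniformClassGroupPNT*.lean`: the
window `1 − 1/(8 log Q) < β < 1`, the error `errorTermN c Q n x = e^{−c log x/log Q} + e^{−√(c log x)/√n}`):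

* (the converse `famF_eq_zero_of_classGroupLFunction` of `classGroupLFunction_eq_zero_of_famF` is in
  `…ClassWindowDH.lean`);
* `decayShape_le_errorTermN` — `𝓓_κ(x) ≤ errorTermN κ Q n x`;
* `log_condQn_ge` — `log|d_K| + log 4 ≤ log Q` (`n ≥ 2`); `window_of_excRegion` — the exceptional segment
  with `c ≤ 1/(8(n²+1))` lies inside the window `(1 − 1/(8 log Q), 1)`; `one_sub_ge_of_not_excRegion` — a
  real point off the segment has `1 − β ≥ c/log Q`;
* `rpow_neg_stark_le` — `Q^{−(2 + max(0, log(1/c₁)))} ≤ c₁ Q^{−2}` (`Q ≥ 12`);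
* `main_ge_half_of_far` — `t − r t^β/β ≥ t/2` for `|r| ≤ 1`, `1/2 ≤ β`, `e^{−(1−β) log t} ≤ 1/8`.

Reference: J. Thorner, A. Zaman, Algebra Number Theory 13 (2019), Thm. 1.4, Thm. 3.1 [ThornerZaman2019].
-/

section Part6

open _root_.Complex _root_.Real _root_.MeasureTheory _root_.Set _root_.Filter _root_.Topology
open scoped _root_.NumberField nonZeroDivisors

namespace Literature.NumberTheory.LFunctions.NumberField.ClassPNT

open Literature.NumberTheory.LFunctions Literature.NumberTheory.LFunctions.NumberField
  Literature.NumberTheory.LFunctions.EntireEF Literature.NumberTheory.LFunctions.TZWeight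
  Literature.NumberTheory.LFunctions.AbelianDensity

variable {K : Type} [Field K] [NumberField K]

/-- **The decay shape is below the printed error term**: for `n ≥ 1` and `log x ≥ 0`,
`e^{−κ log x/log Q} + e^{−√(κ log x)} ≤ errorTermN κ Q n x = e^{−κ log x/log Q} + e^{−√(κ log x)/√n}`.
[cite: ThornerZaman2019, Thm. 1.1] -/
theorem decayShape_le_errorTermN {κ Q x : ℝ} {n : ℕ} (hn : 1 ≤ n) :
    Real.exp (-(κ * Real.log x / Real.log Q)) + Real.exp (-Real.sqrt (κ * Real.log x)) ≤
      ThornerZaman.errorTermN κ Q n x := by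
  rw [ThornerZaman.errorTermN]
  refine add_le_add le_rfl ?_
  rw [Real.exp_le_exp, neg_le_neg_iff]
  have hn1 : (1 : ℝ) ≤ Real.sqrt n := by
    rw [Real.le_sqrt (by norm_num) (Nat.cast_nonneg n)]; norm_num; exact_mod_cast hn
  have h0 : 0 ≤ Real.sqrt (κ * Real.log x) := Real.sqrt_nonneg _
  rw [div_le_iff₀ (by linarith)]
  nlinarith

/-- `log|d_K| + log 4 ≤ log Q` for `Q = |d_K| n^n`, `n = [K:ℚ] ≥ 2` (`n^n ≥ 4`). [cite: ThornerZaman2019, Thm. 1.4 and Thm. 3.1 (small lemmas for the printed form of the error term)] -/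
theorem log_condQn_ge (hK : 1 < Module.finrank ℚ K) :
    Real.log ((NumberField.discr K).natAbs : ℝ) + Real.log 4 ≤ Real.log (ThornerZaman.condQn K) := by
  have hd0 : (0 : ℝ) < ((NumberField.discr K).natAbs : ℝ) := by
    exact_mod_cast Nat.pos_of_ne_zero (Int.natAbs_ne_zero.2 (NumberField.discr_ne_zero K))
  have hn2 : (2 : ℝ) ≤ Module.finrank ℚ K := by exact_mod_cast hK
  have hnn : (4 : ℝ) ≤ (Module.finrank ℚ K : ℝ) ^ Module.finrank ℚ K := by
    calc (4 : ℝ) = 2 ^ 2 := by norm_num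
      _ ≤ (Module.finrank ℚ K : ℝ) ^ 2 := by gcongr
      _ ≤ (Module.finrank ℚ K : ℝ) ^ Module.finrank ℚ K :=
          pow_le_pow_right₀ (by linarith) hK
  have hQ : ThornerZaman.condQn K = ((NumberField.discr K).natAbs : ℝ) *
      (Module.finrank ℚ K : ℝ) ^ Module.finrank ℚ K := by
    rw [ThornerZaman.condQn, Nat.cast_natAbs, Int.cast_abs]
  rw [hQ, Real.log_mul hd0.ne' (by positivity)]
  have := Real.log_le_log (by norm_num) hnn
  linarith

/-- **The exceptional segment lies inside the Thorner–Zaman window**: if `c ≤ 1/(8(n²+1))`, `n = [K:ℚ] > 1`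
and `ρ ∈ excRegion c K` then `1 − 1/(8 log Q) < Re ρ` (`8c log Q ≤ log Q/(n²+1) ≤ log|d_K| + log 4`,
as `n log n ≤ n² log 4`). [cite: ThornerZaman2019, Thm. 3.1] -/
theorem window_of_excRegion {n : ℕ} (hn : 1 < n) (hKn : Module.finrank ℚ K = n) {c : ℝ}
    (hcn : c ≤ 1 / (8 * ((n : ℝ) ^ 2 + 1))) {ρ : ℂ} (hexc : excRegion c K ρ) :
    1 - 1 / (8 * Real.log (ThornerZaman.condQn K)) < ρ.re := by
  have hK : 1 < Module.finrank ℚ K := by rw [hKn]; exact hn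
  have hn2 : (2 : ℝ) ≤ n := by exact_mod_cast hn
  set Q : ℝ := ThornerZaman.condQn K with hQdef
  have hQ12 : (12 : ℝ) ≤ Q := ThornerZaman.twelve_le_condQn (K := K) hK
  have hlogQ : 2 ≤ Real.log Q := two_lt_log_twelve.le.trans (Real.log_le_log (by norm_num) hQ12)
  have hd0 : (0 : ℝ) < ((NumberField.discr K).natAbs : ℝ) := by
    exact_mod_cast Nat.pos_of_ne_zero (Int.natAbs_ne_zero.2 (NumberField.discr_ne_zero K))
  have hlogd : 0 ≤ Real.log ((NumberField.discr K).natAbs : ℝ) := Real.log_natCast_nonneg _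
  have hlog4 : 1 < Real.log 4 := by
    rw [show (4:ℝ) = 2 ^ 2 by norm_num, Real.log_pow]; have := Real.log_two_gt_d9; push_cast; linarith
  -- `log Q = log|d| + n log n` and `n log n ≤ n² log 4`
  have hQ : Q = ((NumberField.discr K).natAbs : ℝ) * (n : ℝ) ^ n := by
    rw [hQdef, ThornerZaman.condQn, Nat.cast_natAbs, Int.cast_abs, hKn]
  have hlogQeq : Real.log Q = Real.log ((NumberField.discr K).natAbs : ℝ) + n * Real.log n := by
    rw [hQ, Real.log_mul hd0.ne' (by positivity), Real.log_pow]
  have hlogn : Real.log n ≤ n * Real.log 4 := by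
    have h1 : Real.log (n : ℝ) ≤ n := by
      have := Real.log_le_sub_one_of_pos (by linarith : (0 : ℝ) < n); linarith
    nlinarith
  have hnlogn : (n : ℝ) * Real.log n ≤ ((n : ℝ) ^ 2 + 1) * (Real.log ((NumberField.discr K).natAbs : ℝ) +
      Real.log 4) := by
    have h0 : 0 ≤ Real.log (n : ℝ) := Real.log_natCast_nonneg _
    nlinarith
  -- hence `c/(log|d| + log 4) ≤ 1/(8 log Q)`
  have hden : 0 < Real.log ((NumberField.discr K).natAbs : ℝ) + Real.log 4 := by linarith
  have hkey : c / (Real.log ((NumberField.discr K).natAbs : ℝ) + Real.log 4) ≤ 1 / (8 * Real.log Q) := by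
    rw [div_le_div_iff₀ hden (by positivity), one_mul]
    have h1 : c * (8 * Real.log Q) ≤ 1 / (8 * ((n : ℝ) ^ 2 + 1)) * (8 * Real.log Q) :=
      mul_le_mul_of_nonneg_right hcn (by positivity)
    have e : 1 / (8 * ((n : ℝ) ^ 2 + 1)) * (8 * Real.log Q) = Real.log Q / ((n : ℝ) ^ 2 + 1) := by
      field_simp
    have h2 : Real.log Q / ((n : ℝ) ^ 2 + 1) ≤ Real.log ((NumberField.discr K).natAbs : ℝ) + Real.log 4 := by
      rw [div_le_iff₀ (by positivity), hlogQeq]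
      nlinarith
    linarith [e ▸ h1]
  obtain ⟨him, hre⟩ := hexc
  linarith

/-- **A real point off the exceptional segment is `≥ c/log Q` away from `1`**: if `¬ excRegion c K β` for a
real `β` then `c/log Q ≤ 1 − β` (`log|d_K| + log 4 ≤ log Q`). [cite: ThornerZaman2019, Thm. 1.4 and Thm. 3.1 (small lemmas for the printed form of the error term)] -/
theorem one_sub_ge_of_not_excRegion (hK : 1 < Module.finrank ℚ K) {c β : ℝ} (hc : 0 < c)
    (hexc : ¬ excRegion c K (β : ℂ)) : c / Real.log (ThornerZaman.condQn K) ≤ 1 - β := by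
  have hQ12 : (12 : ℝ) ≤ ThornerZaman.condQn K := ThornerZaman.twelve_le_condQn (K := K) hK
  have hlogQ : 2 ≤ Real.log (ThornerZaman.condQn K) :=
    two_lt_log_twelve.le.trans (Real.log_le_log (by norm_num) hQ12)
  have hlogd : 0 ≤ Real.log ((NumberField.discr K).natAbs : ℝ) := Real.log_natCast_nonneg _
  have hlog4 : 0 < Real.log 4 := Real.log_pos (by norm_num)
  have hle := log_condQn_ge (K := K) hK
  rw [excRegion, not_and, Complex.ofReal_im, Complex.ofReal_re] at hexc
  have h1 : ¬ (1 - c / (Real.log ((NumberField.discr K).natAbs : ℝ) + Real.log 4) < β) := hexc rfl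
  rw [not_lt] at h1
  have h2 : c / Real.log (ThornerZaman.condQn K) ≤
      c / (Real.log ((NumberField.discr K).natAbs : ℝ) + Real.log 4) :=
    div_le_div_of_nonneg_left hc.le (by linarith) hle
  linarith

/-- **Stark's `c₁ Q^{−2}` dominates a power of `Q`**: for `Q ≥ 12` and `0 < c₁`,
`Q^{−(2 + max(0, log(1/c₁)))} ≤ c₁ Q^{−2}`. [cite: ThornerZaman2019, Thm. 1.4 and Thm. 3.1 (small lemmas for the printed form of the error term)] -/
theorem rpow_neg_stark_le {Q c₁ : ℝ} (hQ : 12 ≤ Q) (hc₁ : 0 < c₁) :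
    Q ^ (-(2 + max 0 (Real.log (1 / c₁)))) ≤ c₁ * Q ^ (-(2 : ℝ)) := by
  have hQ0 : 0 < Q := by linarith
  set m : ℝ := max 0 (Real.log (1 / c₁)) with hm
  have hm0 : 0 ≤ m := le_max_left _ _
  have hsplit : Q ^ (-(2 + m)) = Q ^ (-(2 : ℝ)) * Q ^ (-m) := by
    rw [← Real.rpow_add hQ0]; ring_nf
  have hQm : Q ^ (-m) ≤ c₁ := by
    have hlog12 : (1 : ℝ) ≤ Real.log 12 := by
      rw [Real.le_log_iff_exp_le (by norm_num)]
      have := Real.exp_one_lt_d9; linarith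
    have hlogQ : 1 ≤ Real.log Q := hlog12.trans (Real.log_le_log (by norm_num) hQ)
    have h1 : Q ^ (-m) ≤ Real.exp (-m) := by
      rw [Real.rpow_def_of_pos hQ0, Real.exp_le_exp]; nlinarith
    have h2 : Real.exp (-m) ≤ c₁ := by
      rw [Real.exp_neg]
      have h3 : 1 / c₁ ≤ Real.exp m := by
        calc 1 / c₁ = Real.exp (Real.log (1 / c₁)) := (Real.exp_log (by positivity)).symm
          _ ≤ Real.exp m := Real.exp_le_exp.2 (le_max_right _ _)
      calc (Real.exp m)⁻¹ ≤ (1 / c₁)⁻¹ := inv_anti₀ (by positivity) h3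
        _ = c₁ := by rw [one_div, inv_inv]
    exact h1.trans h2
  rw [hsplit, mul_comm]
  exact mul_le_mul_of_nonneg_right hQm (Real.rpow_nonneg hQ0.le _)

/-- **The main term with a far real zero is at least `t/2`**: for `t > 1`, `|r| ≤ 1`, `1/2 ≤ β` and
`e^{−(1 − β) log t} ≤ 1/8`: `t/2 ≤ t − r t^β/β` and `|r| t^β/β ≤ t/2`. [cite: ThornerZaman2019, Thm. 1.4 and Thm. 3.1 (small lemmas for the printed form of the error term)] -/
theorem main_ge_half_of_far {t β r : ℝ} (ht : 1 < t) (hr : |r| ≤ 1) (hβ : 1 / 2 ≤ β)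
    (hfar : Real.exp (-((1 - β) * Real.log t)) ≤ 1 / 8) :
    t / 2 ≤ t - r * t ^ β / β ∧ |r| * (t ^ β / β) ≤ t / 2 := by
  have ht0 : 0 < t := by linarith
  have hβ0 : 0 < β := by linarith
  have htβ : t ^ β = t * Real.exp (-((1 - β) * Real.log t)) := by
    rw [Real.rpow_def_of_pos ht0, show Real.log t * β = Real.log t + -((1 - β) * Real.log t) by ring,
      Real.exp_add, Real.exp_log ht0]
  have htβ0 : 0 < t ^ β := Real.rpow_pos_of_pos ht0 β
  have h1 : t ^ β / β ≤ t / 2 := by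
    rw [div_le_iff₀ hβ0, htβ]
    have := mul_le_mul_of_nonneg_left hfar ht0.le
    nlinarith
  have h2 : |r| * (t ^ β / β) ≤ t / 2 := by
    calc |r| * (t ^ β / β) ≤ 1 * (t ^ β / β) := mul_le_mul_of_nonneg_right hr (by positivity)
      _ = t ^ β / β := one_mul _
      _ ≤ t / 2 := h1
  refine ⟨?_, h2⟩
  have h3 : r * t ^ β / β ≤ |r| * (t ^ β / β) := by
    rw [mul_div_assoc]
    exact mul_le_mul_of_nonneg_right (le_abs_self r) (by positivity)
  linarith

end Literature.NumberTheory.LFunctions.NumberField.ClassPNT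

end Part6

/-!
## Part 7 — port of `Summits/QuantumAdvantage/QuantumAdvantage/Theorems/LinnikCubicClassGroupsDegreeOnePrimesEscapePerCharacterDeficitDensity.lean` (1 declarations kept)

# The log-free zero-density hypothesis, restricted to ONE character, in `Q`-form

The hypothesis here is the log-free zero-density estimate for the family `{L₀(s,χ)}_{χ ≠ 1}` of
class group `L`-functions of a number field of degree `n`, in the shape of the tree's
`logFreeDensity_classGroup`: a size parameter `P ≥ 2` dominating `|d_K|`, `h_K`, `κ_K⁻¹` and the
heights, and `Σ_{ψ ≠ 0} Σ_{ρ ∈ Z(χ_ψ), β ≥ α} m(ρ) ≤ C_D P^{c_D(1−α)}`. Here we restrict it to ONE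
character `χ ≠ 1` (all terms are `≥ 0`) and put `P = Q^a (T + 2)`, `Q = condQn K = |d_K| n^n`,
`a = max A 4`, for fields with `κ_K ≥ Q^{−A}` (`|d_K| ≤ Q`, `h_K ≤ Q⁴`, `classNumber_le_condQn_pow`):
`Σ_{ρ ∈ u, β ≥ α} m(ρ) ≤ C_D e^{c_D (a log Q + log(T + 4))(1−α)}` for every finite set `u` of zeros of
`L₀(·,χ)` with `1/4 ≤ β < 1`, `|γ| ≤ T` (`T ≥ 1`, `α ≤ 1`) — the shape consumed by
`LinnikZeroSum.sum_rpow_div_le_of_density_zfr` (`density_oneChar`).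
-/

section Part7

open _root_.Complex _root_.Real
open scoped _root_.NumberField nonZeroDivisors
open Literature.NumberTheory.LFunctions Literature.NumberTheory.LFunctions.NumberField
  Literature.NumberTheory.LFunctions.AbelianDensity Literature.NumberTheory.LFunctions.LogFreeLocal

namespace Literature.NumberTheory.LFunctions.NumberField.ClassPNT

/-- The size parameter `P = Q^a (T + 2)` is admissible: `P ≥ 2`, `|d_K| ≤ P`, `h_K ≤ P`,
`P⁻¹ ≤ κ_K`, `T ≤ P`, for `a ≥ max A 4`, `κ_K ≥ Q^{−A}`, `T ≥ 1`, `n_K > 1`.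
[cite: ThornerZaman2019, Thm. 3.2 (log-free zero density, one character, Q-form)] -/
theorem sizeParam_admissible (K : Type) [Field K] [NumberField K] (hK : 1 < Module.finrank ℚ K)
    {A a T : ℝ} (haA : A ≤ a) (ha4 : 4 ≤ a) (hT : 1 ≤ T)
    (hκ : ThornerZaman.condQn K ^ (-A) ≤ NumberField.dedekindZeta_residue K) :
    2 ≤ ThornerZaman.condQn K ^ a * (T + 2) ∧
      ((NumberField.discr K).natAbs : ℝ) ≤ ThornerZaman.condQn K ^ a * (T + 2) ∧
      (Fintype.card (ClassGroup (𝓞 K)) : ℝ) ≤ ThornerZaman.condQn K ^ a * (T + 2) ∧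
      (ThornerZaman.condQn K ^ a * (T + 2))⁻¹ ≤ NumberField.dedekindZeta_residue K ∧
      T ≤ ThornerZaman.condQn K ^ a * (T + 2) := by
  set Q : ℝ := ThornerZaman.condQn K with hQ
  have hQ12 : (12 : ℝ) ≤ Q := ThornerZaman.twelve_le_condQn (K := K) hK
  have hQ1 : (1 : ℝ) ≤ Q := by linarith
  have hQa1 : (1 : ℝ) ≤ Q ^ a := Real.one_le_rpow hQ1 (by linarith)
  have hQaQ : Q ≤ Q ^ a := by
    have : Q ^ (1 : ℝ) ≤ Q ^ a := Real.rpow_le_rpow_of_exponent_le hQ1 (by linarith)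
    rwa [Real.rpow_one] at this
  have hP_ge : Q ^ a ≤ Q ^ a * (T + 2) := by nlinarith
  have hd : ((NumberField.discr K).natAbs : ℝ) ≤ Q := by
    rw [hQ, ThornerZaman.condQn, Nat.cast_natAbs, Int.cast_abs]
    have hn1 : (1 : ℝ) ≤ (Module.finrank ℚ K : ℝ) ^ Module.finrank ℚ K := by
      have : (1 : ℝ) ≤ Module.finrank ℚ K := by
        exact_mod_cast Module.finrank_pos (R := ℚ) (M := K)
      exact one_le_pow₀ this
    nlinarith [abs_nonneg ((NumberField.discr K : ℝ))]
  have hh : (Fintype.card (ClassGroup (𝓞 K)) : ℝ) ≤ Q ^ a := by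
    have h1 := ThornerZaman.classNumber_le_condQn_pow (K := K) hK
    rw [show (Fintype.card (ClassGroup (𝓞 K)) : ℝ) = (NumberField.classNumber K : ℝ) from rfl]
    refine h1.trans ?_
    rw [← hQ, ← Real.rpow_natCast]
    exact Real.rpow_le_rpow_of_exponent_le hQ1 (by push_cast; linarith)
  have hκ' : (Q ^ a * (T + 2))⁻¹ ≤ NumberField.dedekindZeta_residue K := by
    refine le_trans ?_ hκ
    rw [Real.rpow_neg (by linarith)]
    refine inv_anti₀ (Real.rpow_pos_of_pos (by linarith) _) ?_
    exact (Real.rpow_le_rpow_of_exponent_le hQ1 haA).trans hP_ge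
  refine ⟨by nlinarith, hd.trans (hQaQ.trans hP_ge), hh.trans hP_ge, hκ', by nlinarith⟩

end Literature.NumberTheory.LFunctions.NumberField.ClassPNT

end Part7

/-!
## Part 8 — port of `Summits/QuantumAdvantage/QuantumAdvantage/Theorems/LinnikCubicClassGroupsDegreeOnePrimesEscapeClassPNTFamilyDensity.lean` (1 declarations kept)

# The additive class prime number theorem, I: log-free zero density for the whole family
# `{ζ₁_K} ∪ {L₀(s,χ)}_{χ ≠ 1}` of a number field of ONE degree, in `Q`-form

The tree's `fam_density` (`Literature/…/UniformClassGroupZeroSum.lean`) packages the log-free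
zero-density estimates of the family `F_ψ` (`F_0 = ζ₁_K`, `F_ψ = L₀(·, χ_ψ)`) for IMAGINARY QUADRATIC
fields.  Here is the same package for the number fields of an arbitrary fixed degree `n > 1`, fed by the
all-degree estimates `logFreeDensity_classGroup_all` (X1) and `logFreeDensity_dedekindZeta₁_all` (X2) of
the cell, with the residue lower bound `κ_K ≥ Q^{−A}` (`Q = condQn K = |d_K| n^n`) kept as a hypothesis
and the size parameter `P = Q^a (T + 2)`, `a = max A 4` (`sizeParam_admissible`):

* `fam_density_local (n) (hn) (A)` — there are `b, D > 0` (depending on `n, A`) such that for every `K`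
  of degree `n` with `κ_K ≥ Q^{−A}`, every `T ≥ 1`, `α ≤ 1` and all finite sets `u ψ` of zeros of `F_ψ`
  with `1/4 ≤ β < 1`, `|γ| ≤ T`:
  `Σ_ψ Σ_{ρ ∈ u ψ, α ≤ β} m_ψ(ρ) ≤ D · e^{b(a log Q + log(T + 4))(1 − α)}`.

## References

* J. Thorner, A. Zaman, ANT 13 (2019), Theorem 3.2 (without the Deuring–Heilbronn factor). [ThornerZaman2019]
* A. Weiss, J. reine angew. Math. 338 (1983), Thm. 4.3. [Weiss1983]
-/

section Part8

open _root_.Complex _root_.Real _root_.MeasureTheory _root_.Set _root_.Filter _root_.Topology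
open scoped _root_.NumberField nonZeroDivisors

namespace Literature.NumberTheory.LFunctions.NumberField.ClassPNT

open Literature.NumberTheory.LFunctions Literature.NumberTheory.LFunctions.NumberField
  Literature.NumberTheory.LFunctions.EntireEF Literature.NumberTheory.LFunctions.LogFreeDensity
  Literature.NumberTheory.LFunctions.LogFreeLocal Literature.NumberTheory.LFunctions.AbelianDensity

/-- **Log-free zero density for the family of a number field of degree `n`, in `Q`-form** (the
degree-local twin of the tree's `fam_density`): there are `b, D > 0` such that for every number field
`K` of degree `n > 1` with `κ_K ≥ Q^{−A}`, every `T ≥ 1`, every `α ≤ 1` and all finite sets `u ψ` of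
zeros of `F_ψ` with `1/4 ≤ β < 1`, `|γ| ≤ T`:
`Σ_ψ Σ_{ρ ∈ u ψ, α ≤ β} m_ψ(ρ) ≤ D · e^{b(a log Q + log(T + 4))(1 − α)}`, `a = max A 4`, `Q = condQn K`
(`logFreeDensity_classGroup_all` + `logFreeDensity_dedekindZeta₁_all` at `P = Q^a (T + 2)`).
[cite: ThornerZaman2019, Thm. 3.2 (log-free zero density for the whole family, Q-form; Weiss 1983 Thm. 4.3)] -/
theorem fam_density_local (n : ℕ) (hn : 1 < n) (A : ℝ) : ∃ b D : ℝ, 0 < b ∧ 0 < D ∧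
    ∀ (K : Type) [Field K] [NumberField K], Module.finrank ℚ K = n →
      ThornerZaman.condQn K ^ (-A) ≤ NumberField.dedekindZeta_residue K →
      ∀ (T : ℝ), 1 ≤ T → ∀ u : AddChar (Additive (ClassGroup (𝓞 K))) ℂ → Finset ℂ,
        (∀ ψ, ∀ ρ ∈ u ψ, famF K ψ ρ = 0 ∧ 1 / 4 ≤ ρ.re ∧ ρ.re < 1 ∧ |ρ.im| ≤ T) →
        ∀ α : ℝ, α ≤ 1 →
          ∑ ψ, ∑ ρ ∈ u ψ with α ≤ ρ.re, (famMult K ψ ρ : ℝ) ≤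
            D * Real.exp (b * (max A 4 * Real.log (ThornerZaman.condQn K) + Real.log (T + 4))) ^ (1 - α) := by
  classical
  obtain ⟨c₁, C₁, hc₁, hC₁, hCG⟩ := logFreeDensity_classGroup_all n
  obtain ⟨c₂, C₂, hc₂, hC₂, hZ1⟩ := logFreeDensity_dedekindZeta₁_all n
  refine ⟨max c₁ c₂, C₁ + C₂, by positivity, by positivity, fun K _ _ hKn hκ T hT u hu α hα1 ↦ ?_⟩
  have hK : 1 < Module.finrank ℚ K := by rw [hKn]; exact hn
  set a : ℝ := max A 4 with ha
  set Q : ℝ := ThornerZaman.condQn K with hQ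
  have hQ12 : (12 : ℝ) ≤ Q := ThornerZaman.twelve_le_condQn (K := K) hK
  have hQ1 : (1 : ℝ) ≤ Q := by linarith
  set P : ℝ := Q ^ a * (T + 2) with hP
  obtain ⟨hP2, hdP, hhP, hκP, hTP⟩ :=
    sizeParam_admissible K hK (le_max_left A 4) (le_max_right A 4) hT hκ
  -- clamp `α` at `0`
  set α' : ℝ := max α 0 with hα'
  have hα'0 : 0 ≤ α' := le_max_right _ _
  have hα'1 : α' ≤ 1 := max_le hα1 zero_le_one
  have hfilter : ∀ ψ, (u ψ).filter (fun ρ ↦ α ≤ ρ.re) = (u ψ).filter (fun ρ ↦ α' ≤ ρ.re) := by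
    intro ψ
    refine Finset.filter_congr fun ρ hρ ↦ ?_
    have := (hu ψ ρ hρ).2.1
    rw [hα', max_le_iff]
    exact ⟨fun h ↦ ⟨h, by linarith⟩, fun h ↦ h.1⟩
  simp_rw [hfilter]
  -- the `χ ≠ 1` part
  set Z : (ClassGroup (𝓞 K) →* ℂˣ) → Finset ℂ := fun χ ↦
    (Finset.univ.filter fun ψ : AddChar (Additive (ClassGroup (𝓞 K))) ℂ ↦
      (toMulHom ψ).toHomUnits = χ).biUnion u with hZdef
  have hZψ : ∀ ψ, Z (toMulHom ψ).toHomUnits = u ψ := by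
    intro ψ
    rw [hZdef]; dsimp only
    have : (Finset.univ.filter fun ψ' : AddChar (Additive (ClassGroup (𝓞 K))) ℂ ↦
        (toMulHom ψ').toHomUnits = (toMulHom ψ).toHomUnits) = {ψ} := by
      ext ψ'
      simp only [Finset.mem_filter, Finset.mem_univ, true_and, Finset.mem_singleton]
      exact ⟨fun h ↦ toHomUnits_toMulHom_injective h, fun h ↦ by rw [h]⟩
    rw [this, Finset.singleton_biUnion]
  have hline : ∀ χ : ClassGroup (𝓞 K) →* ℂˣ, χ ≠ 1 → ∀ ρ : ℂ,
      classGroupLFunction₀ K χ ρ = 0 → ρ.re < 1 := by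
    intro χ hχ ρ h0
    by_contra h1; rw [not_lt] at h1
    exact classGroupLFunction₀_ne_zero_of_one_le_re hχ h1 h0
  have hZ : ∀ χ : ClassGroup (𝓞 K) →* ℂˣ, χ ≠ 1 → ∀ ρ ∈ Z χ,
      classGroupLFunction₀ K χ ρ = 0 ∧ 1 / 4 ≤ ρ.re ∧ ρ.re < 1 ∧ |ρ.im| ≤ P := by
    intro χ hχ ρ hρ
    rw [hZdef] at hρ; dsimp only at hρ
    rw [Finset.mem_biUnion] at hρ
    obtain ⟨ψ, hψ, hρu⟩ := hρ
    rw [Finset.mem_filter] at hψ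
    have hψ0 : ψ ≠ 0 := by
      rintro rfl; rw [toHomUnits_toMulHom_zero] at hψ; exact hχ hψ.2.symm
    obtain ⟨h0, h14, h1, hT'⟩ := hu ψ ρ hρu
    rw [famF_of_ne hψ0, hψ.2] at h0
    exact ⟨h0, h14, h1, hT'.trans hTP⟩
  have hA := hCG K hKn hline P hP2 hdP hhP hκP Z hZ α' hα'0 hα'1
  -- the `ζ_K` part
  have hZ0 : ∀ ρ ∈ u 0, dedekindZeta₁ K ρ = 0 ∧ 1 / 4 ≤ ρ.re ∧ ρ.re < 1 ∧ |ρ.im| ≤ P := by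
    intro ρ hρ
    obtain ⟨h0, h14, h1, hT'⟩ := hu 0 ρ hρ
    rw [famF_zero] at h0
    exact ⟨h0, h14, h1, hT'.trans hTP⟩
  have hB := hZ1 K hKn P hP2 hdP hhP hκP (u 0) hZ0 α' hα'0 hα'1
  -- assemble: split `Σ_ψ` into `ψ = 0` and `ψ ≠ 0`
  rw [← Finset.sum_filter_add_sum_filter_not Finset.univ
    (fun ψ ↦ ψ = (0 : AddChar (Additive (ClassGroup (𝓞 K))) ℂ))]
  rw [Finset.filter_eq' Finset.univ (0 : AddChar (Additive (ClassGroup (𝓞 K))) ℂ),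
    if_pos (Finset.mem_univ _), Finset.sum_singleton]
  have hA' : ∑ ψ ∈ Finset.univ.filter (fun ψ ↦ ¬ ψ = (0 : AddChar (Additive (ClassGroup (𝓞 K))) ℂ)),
      ∑ ρ ∈ (u ψ).filter (fun ρ ↦ α' ≤ ρ.re), (famMult K ψ ρ : ℝ) ≤ C₁ * P ^ (c₁ * (1 - α')) := by
    refine le_of_eq_of_le ?_ hA
    refine Finset.sum_congr rfl fun ψ hψ ↦ ?_
    rw [Finset.mem_filter] at hψ
    rw [hZψ]
    refine Finset.sum_congr rfl fun ρ _ ↦ ?_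
    rw [famMult, famF_of_ne hψ.2]; rfl
  have hB' : ∑ ρ ∈ (u 0).filter (fun ρ ↦ α' ≤ ρ.re), (famMult K 0 ρ : ℝ) ≤ C₂ * P ^ (c₂ * (1 - α')) := by
    refine le_of_eq_of_le (Finset.sum_congr rfl fun ρ _ ↦ ?_) hB
    rw [famMult, famF_zero]; rfl
  -- `P^{c(1-α')} ≤ exp(b(a log Q + log(T+4)))^{1-α}`
  set B : ℝ := Real.exp (max c₁ c₂ * (a * Real.log Q + Real.log (T + 4))) with hBdef
  have hP1 : (1 : ℝ) ≤ P := by linarith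
  have ha0 : 0 ≤ a := le_trans (by norm_num) (le_max_right A 4)
  have hQa0 : 0 < Q ^ a := Real.rpow_pos_of_pos (by linarith) _
  have hPexp : P ≤ Real.exp (a * Real.log Q + Real.log (T + 4)) := by
    rw [Real.exp_add, Real.exp_log (by linarith), show a * Real.log Q = Real.log (Q ^ a) by
      rw [Real.log_rpow (by linarith)], Real.exp_log hQa0, hP]
    nlinarith
  have hpow : ∀ {c : ℝ}, 0 < c → c ≤ max c₁ c₂ → P ^ (c * (1 - α')) ≤ B ^ (1 - α) := by
    intro c hc hcm
    have h1α : 0 ≤ 1 - α' := by linarith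
    have hαα : 1 - α' ≤ 1 - α := by rw [hα']; exact sub_le_sub_left (le_max_left _ _) _
    have hB1 : 1 ≤ B := Real.one_le_exp (by
      have : 0 ≤ Real.log Q := Real.log_nonneg hQ1
      have : 0 ≤ Real.log (T + 4) := Real.log_nonneg (by linarith)
      positivity)
    calc P ^ (c * (1 - α')) = (P ^ c) ^ (1 - α') := by rw [Real.rpow_mul (by linarith)]
      _ ≤ (Real.exp (a * Real.log Q + Real.log (T + 4)) ^ (max c₁ c₂)) ^ (1 - α') := by
          refine Real.rpow_le_rpow (by positivity) ?_ h1α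
          have hE1 : 1 ≤ Real.exp (a * Real.log Q + Real.log (T + 4)) := by linarith
          exact (Real.rpow_le_rpow (by linarith) hPexp hc.le).trans
            (Real.rpow_le_rpow_of_exponent_le hE1 hcm)
      _ = B ^ (1 - α') := by
          rw [hBdef, ← Real.exp_mul]; ring_nf
      _ ≤ B ^ (1 - α) := Real.rpow_le_rpow_of_exponent_le hB1 hαα
  have h1 := hpow hc₁ (le_max_left _ _)
  have h2' := hpow hc₂ (le_max_right _ _)
  have hBpos : 0 ≤ B ^ (1 - α) := Real.rpow_nonneg (Real.exp_pos _).le _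
  calc ∑ ρ ∈ (u 0).filter (fun ρ ↦ α' ≤ ρ.re), (famMult K 0 ρ : ℝ) +
        ∑ ψ ∈ Finset.univ.filter (fun ψ ↦ ¬ ψ = (0 : AddChar (Additive (ClassGroup (𝓞 K))) ℂ)),
          ∑ ρ ∈ (u ψ).filter (fun ρ ↦ α' ≤ ρ.re), (famMult K ψ ρ : ℝ)
      ≤ C₂ * P ^ (c₂ * (1 - α')) + C₁ * P ^ (c₁ * (1 - α')) := add_le_add hB' hA'
    _ ≤ C₂ * B ^ (1 - α) + C₁ * B ^ (1 - α) :=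
        add_le_add (mul_le_mul_of_nonneg_left h2' hC₂.le) (mul_le_mul_of_nonneg_left h1 hC₁.le)
    _ = (C₁ + C₂) * B ^ (1 - α) := by ring

end Literature.NumberTheory.LFunctions.NumberField.ClassPNT

end Part8

/-!
## Part 9 — port of `Summits/QuantumAdvantage/QuantumAdvantage/Theorems/LinnikCubicClassGroupsDegreeOnePrimesEscapeResidueAllFields.lean` (3 declarations kept)

# The residue bound `κ_K ≥ Q^{−A(n)}` for EVERY number field, in all degrees

* `Residue.one_le_residue_of_finrank_eq_one` — a degree-one field has `κ_K ≥ 1` (`r₁ = 1`, `r₂ = 0`, `w_K = 2`,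
  `|d_K| = 1`, `h_K ≥ 1`, and `R_K ≥ 1` from Minkowski's bound `t^{rank} ≤ R_K` at `rank = 0`,
  `Literature.NumberTheory.NumberFields.pow_rank_le_regulator_of_le_norm_logEmbedding`).
* `Residue.residueLowerBound_all : ∀ n, ∃ A ≥ 0, ∀ K of degree n, condQn K ^ (−A) ≤ κ_K` — ALL degrees, ALL fields
  (degree `≥ 2`: `ThornerZaman.exists_condQn_rpow_neg_le_residue`, Literature `DedekindResidueCondQnLowerBound.lean`;
  degree `1`: the bullet above with `A = 0`; degree `0`: vacuous).
-/

section Part9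

open _root_.Module _root_.NumberField _root_.NumberField.InfinitePlace NumberField.Units
open Literature.NumberTheory.LFunctions Literature.NumberTheory.LFunctions.NumberField
  Literature.NumberTheory.NumberFields

namespace Literature.NumberTheory.LFunctions.NumberField.ClassPNT

namespace Residue

/-- A number field of degree `1` has `|d_K| = 1` (it is `ℚ`). [cite: ThornerZaman2019, §3 (residue lower bound κ_K ≥ Q^{−A(n)} in every degree; Stark 1974)]
(Same statement as `Literature…natAbs_discr_eq_one_of_finrank_eq_one`; re-proved here to keep the imports light.) -/
theorem abs_discr_eq_one_of_finrank_eq_one (K : Type) [Field K] [NumberField K]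
    (h : Module.finrank ℚ K = 1) : |(discr K : ℝ)| = 1 := by
  have hbot : (⊥ : IntermediateField ℚ K) = ⊤ := by
    apply IntermediateField.eq_of_le_of_finrank_eq bot_le
    rw [IntermediateField.finrank_bot, IntermediateField.finrank_top', h]
  have e : K ≃ₐ[ℚ] ℚ := (IntermediateField.topEquiv.symm.trans
    (IntermediateField.equivOfEq hbot.symm)).trans (IntermediateField.botEquiv ℚ K)
  rw [NumberField.discr_eq_discr_of_algEquiv _ e, NumberField.discr_rat]
  simp

open scoped _root_.Classical in
/-- **A degree-one number field has `κ_K ≥ 1`** (in fact `= 1`): `κ_K = 2^{r₁}(2π)^{r₂} R h/(w √|d|)` with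
`r₁ = 1`, `r₂ = 0`, `w = 2`, `|d| = 1`, `h ≥ 1` and `R ≥ 1` (Minkowski's `t^{rank} ≤ R` at `rank = 0`). [cite: ThornerZaman2019, §3 (residue lower bound κ_K ≥ Q^{−A(n)} in every degree; Stark 1974)] -/
theorem one_le_residue_of_finrank_eq_one (K : Type) [Field K] [NumberField K]
    (h1 : Module.finrank ℚ K = 1) : 1 ≤ dedekindZeta_residue K := by
  have hrc : nrRealPlaces K + 2 * nrComplexPlaces K = 1 := by rw [card_add_two_mul_card_eq_rank, h1]
  have hc : nrComplexPlaces K = 0 := by omega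
  have hr : nrRealPlaces K = 1 := by omega
  have hrank : rank K = 0 := by
    rw [rank, card_eq_nrRealPlaces_add_nrComplexPlaces, hr, hc]
  have hw : torsionOrder K = 2 := torsionOrder_eq_two_of_odd_finrank (by rw [h1]; exact odd_one)
  have hd : |(discr K : ℝ)| = 1 := abs_discr_eq_one_of_finrank_eq_one K h1
  have hreg : 1 ≤ regulator K := by
    obtain ⟨g, hg, hgap⟩ := exists_norm_logEmbedding_gt_of_finrank_le 1
    have := pow_rank_le_regulator_of_le_norm_logEmbedding K hg (fun u hu => (hgap K h1.le u hu).le)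
    rwa [hrank, pow_zero] at this
  have hh : (1 : ℝ) ≤ classNumber K := by exact_mod_cast classNumber_pos K
  rw [dedekindZeta_residue_def, hr, hc, hw, hd]
  have : (2 : ℝ) ^ 1 * (2 * Real.pi) ^ 0 * regulator K * (classNumber K : ℝ) / (((2 : ℕ) : ℝ) * Real.sqrt 1) =
      regulator K * classNumber K := by
    rw [Real.sqrt_one]; push_cast; ring
  rw [this]
  exact one_le_mul_of_one_le_of_one_le hreg hh

/-- **R for every number field, every degree:** `∀ n, ∃ A = A(n) ≥ 0, ∀ K of degree n, Q^{−A} ≤ κ_K`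
(`Q = condQn K = |d_K| n^n`).  Degree `≥ 2`: class number formula + regulator lower bound
(`ThornerZaman.exists_condQn_rpow_neg_le_residue`); degree `1`: `κ_K ≥ 1 = Q^0`; degree `0`: no such field.
No hypothesis on subfields, no zero-free region. [cite: ThornerZaman2019, §3 (residue lower bound κ_K ≥ Q^{−A(n)} in every degree; Stark 1974)] -/
theorem residueLowerBound_all : ∀ n : ℕ, ∃ A : ℝ, 0 ≤ A ∧ ∀ (K : Type) [Field K] [NumberField K],
    Module.finrank ℚ K = n → ThornerZaman.condQn K ^ (-A) ≤ NumberField.dedekindZeta_residue K := by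
  intro n
  rcases Nat.lt_or_ge 1 n with hn | hn
  · exact ThornerZaman.exists_condQn_rpow_neg_le_residue n hn
  · refine ⟨0, le_rfl, fun K _ _ hK => ?_⟩
    have hpos : 0 < Module.finrank ℚ K := Module.finrank_pos
    have h1 : Module.finrank ℚ K = 1 := by omega
    rw [neg_zero, Real.rpow_zero]
    exact one_le_residue_of_finrank_eq_one K h1

end Residue

end Literature.NumberTheory.LFunctions.NumberField.ClassPNT

end Part9

/-!
## Part 10 — port of `Summits/QuantumAdvantage/QuantumAdvantage/Theorems/LinnikCubicClassGroupsDegreeOnePrimesEscapeClassPNTDHLinnik.lean` (1 declarations kept)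

# The class prime number theorem with the Deuring–Heilbronn phenomenon, V: the Linnik deduction

Linnik's three principles for the family `{ζ_K} ∪ {L(s,χ)}_{χ ∈ Ĉl_K}` of a number field `K` of degree
`n > 1` — the log-free zero-density estimate (`fam_density_local`), the zero-free
region with at most one exceptional zero (`exists_exceptionalZero_const`), and the Deuring–Heilbronn
phenomenon (hypothesis `hDH`: the statement of
`Literature.NumberTheory.LFunctions.NumberField.deuringHeilbronn` verbatim) — give,
with the residue bound `κ_K ≥ Q^{−A(n)}` (`Residue.residueLowerBound_all`) and Stark's effective repulsion:

* `sub_mul_rpow_div_ge` — the main term: `x − r x^{β}/β ≥ (x/4)·min(1, (1 − β) log x)` for `|r| ≤ 1`,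
  `3/4 ≤ β < 1`, `log x ≥ 16`;
* `thetaClass_relative_of_zeroRepulsion` — **the class prime number theorem with RELATIVE error in the
  Linnik range** (Thorner–Zaman's Theorem 1.4 for the Hilbert class field, `θ`-form): for every `ε > 0`
  and `x ≥ Q^{a₂(n,ε)}`, EITHER `|θ_C(x) − x/h_K| ≤ ε x/h_K` for all `C`, OR
  `|θ_C(x) − M_C(x)/h_K| ≤ ε M_C(x)/h_K` with `M_C(x) = x − χ₁(C) x^{β₁}/β₁ > 0`;
* `exists_prime_mem_class_absNorm_le_of_zeroRepulsion` — **Linnik's theorem for ideal classes in EVERY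
  degree**: there is `L = L(n) > 0` such that every ideal class of every number field of degree `n`
  contains a prime ideal of norm `≤ Q^{L}`, `Q = |d_K|·nⁿ` [Weiss1983, Thm. 5.2 for `H_K/K`; Fogels].

Both are conditional here ONLY on `hDH`; the unconditional versions (import of the landed Literature
theorem) are in `…LeastPrimeIdeal.lean`.

References: J. Thorner, A. Zaman, Algebra Number Theory 13 (2019), Thm. 1.4 [ThornerZaman2019];
A. Weiss, *The least prime ideal*, J. reine angew. Math. 338 (1983) 56–94, Thm. 5.2 [Weiss1983];
E. Bombieri, Astérisque 18, §6 [Bombieri1974].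
-/

section Part10

open _root_.Complex _root_.Real _root_.MeasureTheory _root_.Set _root_.Filter _root_.Topology
open scoped _root_.NumberField nonZeroDivisors

namespace Literature.NumberTheory.LFunctions.NumberField.ClassPNT

open Literature.NumberTheory.LFunctions Literature.NumberTheory.LFunctions.NumberField
  Literature.NumberTheory.LFunctions.EntireEF Literature.NumberTheory.LFunctions.TZWeight
  Literature.NumberTheory.LFunctions.AbelianDensity

/-! ### The main term with the exceptional zero -/

/-- **The main term `x − r x^β/β` is at least `(x/4)·min(1, (1 − β) log x)`** for `|r| ≤ 1`,
`3/4 ≤ β < 1` and `log x ≥ 16` (`x^β = x e^{−t}`, `t = (1 − β) log x`, `e^{−t} ≤ 1/(1 + t)`). [cite: ThornerZaman2019, Thm. 1.4 (the Linnik-type deduction; Weiss 1983 Thm. 5.2)] -/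
theorem sub_mul_rpow_div_ge {x β r : ℝ} (hx : 1 < x) (hL : 16 ≤ Real.log x) (hβ : 3 / 4 ≤ β)
    (hβ1 : β < 1) (hr : |r| ≤ 1) :
    x / 4 * min 1 ((1 - β) * Real.log x) ≤ x - r * x ^ β / β := by
  have hx0 : 0 < x := by linarith
  have hβ0 : 0 < β := by linarith
  set L : ℝ := Real.log x with hL'
  set t : ℝ := (1 - β) * L with ht
  have hδ0 : 0 < 1 - β := by linarith
  have ht0 : 0 < t := mul_pos hδ0 (by linarith)
  -- `x^β = x e^{-t}`
  set e : ℝ := Real.exp (-t) with he'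
  have he0 : 0 < e := Real.exp_pos _
  have hxβ : x ^ β = x * e := by
    rw [he', Real.rpow_def_of_pos hx0, ← hL', show L * β = L + -t by rw [ht]; ring, Real.exp_add,
      Real.exp_log hx0]
  -- `e ≤ 1/(1+t)`, i.e. `e (1 + t) ≤ 1`
  have het : e * (1 + t) ≤ 1 := by
    have h1 : 1 + t ≤ Real.exp t := by linarith [Real.add_one_le_exp t]
    have h2 : e * Real.exp t = 1 := by rw [he', ← Real.exp_add]; simp
    nlinarith [mul_le_mul_of_nonneg_left h1 he0.le]
  -- `r x^β/β ≤ x^β/β`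
  have hr1 : r ≤ 1 := (abs_le.1 hr).2
  have h1 : r * x ^ β / β ≤ x ^ β / β := by
    refine div_le_div_of_nonneg_right ?_ hβ0.le
    have := Real.rpow_pos_of_pos hx0 β
    nlinarith
  -- `1 ≤ (1 + t) β (1 − m/4)`, `m = min 1 t`
  set m : ℝ := min 1 t with hm
  have hkey : 1 ≤ (1 + t) * β * (1 - m / 4) := by
    rcases le_or_gt 1 t with h1t | ht1
    · rw [hm, min_eq_left h1t]
      nlinarith
    · rw [hm, min_eq_right ht1.le]
      -- `β ≥ 1 − t/16` since `1 − β = t/L ≤ t/16`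
      have hβt : 1 - t / 16 ≤ β := by
        have : (1 - β) * 16 ≤ (1 - β) * L := mul_le_mul_of_nonneg_left hL hδ0.le
        rw [← ht] at this; linarith
      have htt : t ^ 2 ≤ t := by nlinarith
      have hA : 1 + t / 2 ≤ (1 + t) * (1 - t / 4) := by nlinarith
      have hB : 1 ≤ (1 + t / 2) * (1 - t / 16) := by nlinarith
      have hC : (1 + t / 2) * (1 - t / 16) ≤ (1 + t) * (1 - t / 4) * (1 - t / 16) :=
        mul_le_mul_of_nonneg_right hA (by linarith)
      have hD : (1 + t) * (1 - t / 4) * (1 - t / 16) ≤ (1 + t) * (1 - t / 4) * β :=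
        mul_le_mul_of_nonneg_left hβt (by nlinarith)
      nlinarith
  -- hence `e ≤ β (1 − m/4)` and `x − x e/β ≥ x m/4`
  have hm1 : m ≤ 1 := min_le_left _ _
  have hm0 : 0 < m := lt_min one_pos ht0
  have heβ : e ≤ β * (1 - m / 4) := by
    have h0 : 0 ≤ β * (1 - m / 4) := by nlinarith
    -- `e (1+t) ≤ 1 ≤ (1+t) β (1 − m/4)` and `1 + t > 0`
    have := het.trans hkey
    nlinarith
  have hfin : x / 4 * m ≤ x - x ^ β / β := by
    rw [hxβ]
    have h2 : x * e / β ≤ x * (1 - m / 4) := by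
      rw [div_le_iff₀ hβ0]
      have := mul_le_mul_of_nonneg_left heβ hx0.le
      linarith
    linarith
  exact hfin.trans (by linarith)

/-! ### From `θ_C(x) > 0` to a prime ideal -/

end Literature.NumberTheory.LFunctions.NumberField.ClassPNT

end Part10

/-!
## Part 11 — port of `Summits/QuantumAdvantage/QuantumAdvantage/Theorems/LinnikCubicClassGroupsDegreeOnePrimesEscapeClassWindowDH.lean` (1 declarations kept)

# Prime ideals of a class in short intervals with Deuring–Heilbronn, II: the window dichotomy

`classWindow_dichotomy_dh` (ideal-class analogue of `frobWindow_dichotomy_dh`, gen 17): for `n > 1`, precision `κ > 0`,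
collar floor `0 < e₀ ≤ 1/4` there are `θ, a₁, c` such that for every number field `K` of degree `n`, collar ratio
`e₀Q^{−2} ≤ ε₀ ≤ 1/4`, `x ≥ Q^{a₁}`, `0 < η ≤ log 2` with `x^{−θ/8} ≤ 2η`, window `log x ≤ lo < hi ≤ log x + η`
(`g = windowTest lo hi (ε₀η)`, `F` its Laplace transform) and class `C`:
(A) no real zero of a real class group character in `(1 − c/(log|d_K| + log 4), 1)` ⇒ `‖h_K ψ̃_C(g) − F(−1)‖ ≤ κxη`;
(B) `χ₁` real with the zero `β₁` there ⇒ `‖h_K ψ̃_C(g) − F(−1) + χ₁(C) F(−β₁)‖ ≤ κxη · min(1, (1−β₁) log x)`.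
The gain in (B) is the Deuring–Heilbronn phenomenon (`deuringHeilbronn`, via `zfr_of_zeroRepulsion`, `dh_flat_le`)
with Stark's `1 − β₁ ≥ c₁Q^{−2}` for the secondary terms (`dh_junk_le`); Landau–Page, the log-free density and the
residue bound are discharged inside.
References: [LagariasMontgomeryOdlyzko1979, §7, Thm. 5.1]; [ThornerZaman2019, Thm. 3.1, §5]; G. Hoheisel (1930).
-/

section Part11

open _root_.Complex _root_.Real _root_.MeasureTheory _root_.Set _root_.Filter _root_.Topology
open scoped _root_.NumberField nonZeroDivisors

namespace Literature.NumberTheory.LFunctions.NumberField.ClassPNT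

open Literature.NumberTheory.LFunctions Literature.NumberTheory.LFunctions.NumberField
  Literature.NumberTheory.LFunctions.EntireEF
  Literature.NumberTheory.LFunctions.AbelianDensity

variable {K : Type} [Field K] [NumberField K]

/-! ### Small lemmas -/

/-- A zero `ρ ≠ 1` of `L(s, χ_ψ)` is a zero of the member `F_ψ` of the family (converse of
`classGroupLFunction_eq_zero_of_famF`). [cite: ThornerZaman2019, Thm. 3.1 and §5 (prime ideals of a class in short intervals: the window dichotomy; LMO 1979 §7)] -/
theorem famF_eq_zero_of_classGroupLFunction (ψ : AddChar (Additive (ClassGroup (𝓞 K))) ℂ) {ρ : ℂ}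
    (hρ1 : ρ ≠ 1) (h0 : classGroupLFunction K (toMulHom ψ).toHomUnits ρ = 0) : famF K ψ ρ = 0 := by
  by_cases hψ : ψ = 0
  · subst hψ
    rw [famF_zero]
    rw [toHomUnits_toMulHom_zero] at h0
    by_contra hne
    exact ((dedekindZeta₁_ne_zero_iff (K := K) hρ1).1 hne) h0
  · rw [famF_of_ne hψ, classGroupLFunction₀_eq _ hρ1 (toHomUnits_ne_one hψ)]
    exact h0

end Literature.NumberTheory.LFunctions.NumberField.ClassPNT

end Part11

/-!
## Part 12 — port of `Summits/QuantumAdvantage/QuantumAdvantage/Theorems/LinnikCubicClassGroupsDegreeOnePrimesEscapeClassPNTTZForm.lean` (1 declarations kept)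

# Thorner–Zaman (2019) Thm 1.4 for the Hilbert class field at a fixed degree, `θ_C`-form, and the
# discharge of the named fact `ThornerZaman2019_classPNT_imaginaryQuadratic`

* `classTheta_TZ_dichotomy (n) (hn : 1 < n)` — **[ThornerZaman2019, Thm. 1.4] for `L = H_K`, in `θ_C`-form,
  with constants depending on the degree `n` only**: there are `a, c₂, A, s > 0` such that for every number
  field `K` of degree `n` (`Q = |d_K| n^n`, `h = h_K`, `E(t) = errorTermN c₂ Q n t
  = e^{−c₂ log t/log Q} + e^{−√(c₂ log t)/√n}`), EITHER no real class group character has a real zero of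
  `L(s, χ)` in `(1 − 1/(8 log Q), 1)` and `|θ_C(t) − t/h| ≤ A E(t) t/h` for all classes `C` and `t ≥ Q^a`, OR
  there are a real `χ₁` and a real zero `β₁ ∈ (1 − 1/(8 log Q), 1)` of `L(s, χ₁)` with `Q^{−s} ≤ 1 − β₁`
  (Stark) and `|θ_C(t) − (t − χ₁(C) t^{β₁}/β₁)/h| ≤ A E(t) (t − χ₁(C) t^{β₁}/β₁)/h` for all `C`, `t ≥ Q^a`.
  Assembled from `thetaClass_decay` (`…ClassPNTDHThetaDecay.lean`: Deuring–Heilbronn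
  `Literature…deuringHeilbronn`, log-free density `fam_density_local`, residue bound
  `Residue.residueLowerBound_all`) by the case analysis of [ThornerZaman2019, §5]: a zero on the exceptional
  segment `excRegion c K` is the `β₁` of the second branch (relative error from `sub_mul_rpow_div_ge`); off the
  segment a real zero in the window has `1 − β ≥ c/log Q` and its term `t^β/β ≤ 2t e^{−c log t/log Q}` is part
  of the error; with no real zero in the window the first branch holds.
* **`ThornerZaman2019_classPNT_imaginaryQuadratic_holds`** — the tree's NAMED FACT
  `Literature.NumberTheory.LFunctions.NumberField.ThornerZaman2019_classPNT_imaginaryQuadratic`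
  (`UniformClassGroupPNT.lean`: [ThornerZaman2019, Thm. 1.4] for the ideal classes of imaginary quadratic
  fields, `π_C`-form, error `c₃(e^{−c₂ log x/log(4|d_K|)} + e^{−(c₂ log x/2)^{1/2}})`) is now a THEOREM:
  `n = 2` and the tree's reduction `ThornerZaman2019_classPNT_imaginaryQuadratic_of_thetaForm`
  (`UniformClassGroupPNTReduction.lean`).  The general-degree fact `…_hilbertClassField` asks for constants
  uniform in the degree and is NOT claimed.

References: J. Thorner, A. Zaman, *A unified and improved Chebotarev density theorem*, Algebra Number
Theory 13 (2019) 1039–1068, Thm. 1.4, Thm. 3.1–3.3, §5 [ThornerZaman2019]; A. Weiss, J. reine angew.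
Math. 338 (1983), Thm. 5.2 [Weiss1983]; J. C. Lagarias, H. L. Montgomery, A. M. Odlyzko, Invent. Math. 54
(1979) [LagariasMontgomeryOdlyzko1979].
-/

section Part12

open _root_.Complex _root_.Real _root_.MeasureTheory _root_.Set _root_.Filter _root_.Topology
open scoped _root_.NumberField nonZeroDivisors

namespace Literature.NumberTheory.LFunctions.NumberField.ClassPNT

open Literature.NumberTheory.LFunctions Literature.NumberTheory.LFunctions.NumberField
  Literature.NumberTheory.LFunctions.EntireEF Literature.NumberTheory.LFunctions.TZWeight
  Literature.NumberTheory.LFunctions.AbelianDensity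

set_option maxHeartbeats 1600000 in
/-- **Thorner–Zaman (2019), Theorem 1.4, for `H_K/K` at a fixed degree `n > 1`, `θ_C`-form with the
Landau–Siegel term and decaying relative error** (see the module docstring; constants depend on `n` only).
[cite: ThornerZaman2019, Theorem 1.4] [cite: Weiss1983, Theorem 5.2] -/
theorem classTheta_TZ_dichotomy (n : ℕ) (hn : 1 < n) :
    ∃ a c₂ A s : ℝ, 0 < a ∧ 0 < c₂ ∧ 0 < A ∧ 0 < s ∧
    ∀ (K : Type) [Field K] [NumberField K], Module.finrank ℚ K = n →
      ((∀ χ : ClassGroup (𝓞 K) →* ℂˣ, χ * χ = 1 →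
          ∀ β : ℝ, 1 - 1 / (8 * Real.log (ThornerZaman.condQn K)) < β → β < 1 →
            classGroupLFunction K χ β ≠ 0) ∧
        ∀ (C : ClassGroup (𝓞 K)) (t : ℝ), ThornerZaman.condQn K ^ a ≤ t →
          |chebyshevThetaIdealClass K C t - t / NumberField.classNumber K| ≤
            A * ThornerZaman.errorTermN c₂ (ThornerZaman.condQn K) n t * (t / NumberField.classNumber K)) ∨
      ∃ (χ₁ : ClassGroup (𝓞 K) →* ℂˣ) (β₁ : ℝ), χ₁ * χ₁ = 1 ∧
        1 - 1 / (8 * Real.log (ThornerZaman.condQn K)) < β₁ ∧ β₁ < 1 ∧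
        classGroupLFunction K χ₁ β₁ = 0 ∧
        ThornerZaman.condQn K ^ (-s) ≤ 1 - β₁ ∧
        ∀ (C : ClassGroup (𝓞 K)) (t : ℝ), ThornerZaman.condQn K ^ a ≤ t →
          |chebyshevThetaIdealClass K C t -
              (t - ((χ₁ C : ℂ)).re * t ^ β₁ / β₁) / NumberField.classNumber K| ≤
            A * ThornerZaman.errorTermN c₂ (ThornerZaman.condQn K) n t *
              ((t - ((χ₁ C : ℂ)).re * t ^ β₁ / β₁) / NumberField.classNumber K) := by
  classical
  obtain ⟨AR, -, hAR⟩ := Residue.residueLowerBound_all n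
  obtain ⟨b, D, hb, hD, hdens⟩ := fam_density_local n hn AR
  have ha : (1 : ℝ) ≤ max AR 4 := le_trans (by norm_num) (le_max_right _ _)
  obtain ⟨a₂, c, κ, A, ha₂1, hc, hcn, hκ0, hA0, hθ⟩ := thetaClass_decay n hn hb hD ha deuringHeilbronn
  obtain ⟨c₁, hc₁, hc₁1, heff⟩ := Residue.one_sub_realZero_ge_condQn_rpow n hn
  have hn1 : 1 ≤ n := hn.le
  -- constants
  set a : ℝ := max a₂ (max 8 (3 / c)) with hadef
  have haa₂ : a₂ ≤ a := le_max_left _ _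
  have ha8 : (8 : ℝ) ≤ a := le_trans (le_max_left _ _) (le_max_right _ _)
  have ha3 : 3 / c ≤ a := le_trans (le_max_right _ _) (le_max_right _ _)
  set c₂ : ℝ := min κ c with hc₂def
  have hc₂κ : c₂ ≤ κ := min_le_left _ _
  have hc₂c : c₂ ≤ c := min_le_right _ _
  set s : ℝ := 2 + max 0 (Real.log (1 / c₁)) with hsdef
  have hs0 : 0 < s := by have : 0 ≤ max 0 (Real.log (1 / c₁)) := le_max_left _ _; linarith
  refine ⟨a, c₂, 4 * A + 4, s, by linarith, lt_min hκ0 hc, by positivity, hs0, fun K _ _ hKn ↦ ?_⟩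
  have hK : 1 < Module.finrank ℚ K := by rw [hKn]; exact hn
  obtain ⟨hgoodK, hexcK⟩ := hθ K hKn (hdens K hKn (hAR K hKn))
  have heffK := heff K hKn
  set Q : ℝ := ThornerZaman.condQn K with hQ
  have hQ12 : (12 : ℝ) ≤ Q := ThornerZaman.twelve_le_condQn (K := K) hK
  have hQ1 : (1 : ℝ) < Q := by linarith
  have hQ0 : (0 : ℝ) < Q := by linarith
  have hlogQ : 2 ≤ Real.log Q := two_lt_log_twelve.le.trans (Real.log_le_log (by norm_num) hQ12)
  have hlogQ0 : 0 < Real.log Q := by linarith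
  set h : ℝ := (NumberField.classNumber K : ℝ) with hh
  have hh1 : 1 ≤ h := by rw [hh]; exact_mod_cast one_le_classNumber (K := K)
  have hh0 : 0 < h := by linarith
  have hstark : Q ^ (-s) ≤ c₁ * Q ^ (-(2 : ℝ)) := rpow_neg_stark_le hQ12 hc₁
  -- the window `1 - 1/(8 log Q) ≥ 3/4`
  have hwin34 : (3 : ℝ) / 4 ≤ 1 - 1 / (8 * Real.log Q) := by
    have : 1 / (8 * Real.log Q) ≤ 1 / 16 := by
      rw [div_le_div_iff_of_pos_left one_pos (by positivity) (by norm_num)]; linarith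
    linarith
  -- sizes at `t ≥ Q^a`
  have hsz : ∀ t : ℝ, Q ^ a ≤ t → Q ^ a₂ ≤ t ∧ 1 < t ∧ 16 ≤ Real.log t ∧
      Real.exp (-(c * Real.log t / Real.log Q)) ≤ 1 / 8 ∧
      (Real.exp (-(κ * Real.log t / Real.log Q)) + Real.exp (-Real.sqrt (κ * Real.log t)) ≤
        ThornerZaman.errorTermN c₂ Q n t) ∧
      Real.exp (-(c * Real.log t / Real.log Q)) ≤ ThornerZaman.errorTermN c₂ Q n t := by
    intro t ht
    have hta₂ : Q ^ a₂ ≤ t := le_trans (Real.rpow_le_rpow_of_exponent_le hQ1.le haa₂) ht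
    have htQ : Q ≤ t := by
      have : Q ^ (1 : ℝ) ≤ Q ^ a := Real.rpow_le_rpow_of_exponent_le hQ1.le (by linarith)
      rw [Real.rpow_one] at this; linarith
    have ht1 : 1 < t := by linarith
    have hL : a * Real.log Q ≤ Real.log t := by
      have := Real.log_le_log (by positivity) ht
      rwa [Real.log_rpow hQ0] at this
    have hL0 : 0 ≤ Real.log t := by nlinarith
    have hL16 : 16 ≤ Real.log t := by nlinarith
    have hexp8 : Real.exp (-(c * Real.log t / Real.log Q)) ≤ 1 / 8 := by
      have h3 : 3 ≤ c * Real.log t / Real.log Q := by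
        rw [le_div_iff₀ hlogQ0]
        have h1 : 3 ≤ c * a := by
          have := (div_le_iff₀ hc).1 ha3; linarith
        nlinarith
      calc Real.exp (-(c * Real.log t / Real.log Q)) ≤ Real.exp (-3) := Real.exp_le_exp.2 (by linarith)
        _ ≤ 1 / 8 := by
            rw [Real.exp_neg]
            have h20 : (8 : ℝ) ≤ Real.exp 3 := by
              have := Real.add_one_le_exp (3 : ℝ)
              have h' : Real.exp 3 = Real.exp 1 * Real.exp 1 * Real.exp 1 := by
                rw [← Real.exp_add, ← Real.exp_add]; norm_num
              have he := Real.exp_one_gt_d9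
              rw [h']; nlinarith [mul_pos (Real.exp_pos (1:ℝ)) (Real.exp_pos (1:ℝ))]
            rw [inv_eq_one_div, div_le_div_iff_of_pos_left one_pos (Real.exp_pos 3) (by norm_num)]
            exact h20
    have hDE : Real.exp (-(κ * Real.log t / Real.log Q)) + Real.exp (-Real.sqrt (κ * Real.log t)) ≤
        ThornerZaman.errorTermN c₂ Q n t :=
      (decayShape_mono hL0 hlogQ0 hc₂κ).trans (decayShape_le_errorTermN hn1)
    have hcE : Real.exp (-(c * Real.log t / Real.log Q)) ≤ ThornerZaman.errorTermN c₂ Q n t := by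
      refine le_trans ?_ ((decayShape_mono hL0 hlogQ0 hc₂c).trans (decayShape_le_errorTermN hn1))
      exact le_add_of_nonneg_right (Real.exp_pos _).le
    exact ⟨hta₂, ht1, hL16, hexp8, hDE, hcE⟩
  by_cases hex : ∃ (ψ : AddChar (Additive (ClassGroup (𝓞 K))) ℂ) (ρ : ℂ),
      famF K ψ ρ = 0 ∧ 0 < ρ.re ∧ ρ.re < 1 ∧ excRegion c K ρ
  · -- (1a) an exceptional zero on the segment: the second branch, relative error by Deuring–Heilbronn
    right
    obtain ⟨ψ₁, ρ₁, h0₁, hre₁, hre₁', hexc₁⟩ := hex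
    obtain ⟨hρ₁, hreal, hLzero, hest⟩ := hexcK ψ₁ ρ₁ h0₁ hre₁ hre₁' hexc₁
    set β₁ : ℝ := ρ₁.re with hβ₁
    set χ₁ : ClassGroup (𝓞 K) →* ℂˣ := (toMulHom ψ₁).toHomUnits with hχ₁
    have hwin : 1 - 1 / (8 * Real.log Q) < β₁ := window_of_excRegion (K := K) hn hKn hcn hexc₁
    have hβ1 : β₁ < 1 := hre₁'
    have hβ34 : 3 / 4 ≤ β₁ := by linarith
    have hδ : c₁ * Q ^ (-(2 : ℝ)) ≤ 1 - β₁ := heffK χ₁ hreal β₁ hβ1 hLzero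
    refine ⟨χ₁, β₁, hreal, hwin, hβ1, hLzero, hstark.trans hδ, fun C t ht ↦ ?_⟩
    obtain ⟨hta₂, ht1, hL16, -, hDE, -⟩ := hsz t ht
    have ht0 : 0 < t := by linarith
    have h1 := hest t hta₂ C
    have hr := abs_re_classGroupChar_apply_le hreal C
    have hmain := sub_mul_rpow_div_ge ht1 hL16 hβ34 hβ1 hr
    set m : ℝ := min 1 ((1 - β₁) * Real.log t) with hm
    set g : ℝ := t - ((χ₁ C : ℂ)).re * t ^ β₁ / β₁ with hg
    set Dκ : ℝ := Real.exp (-(κ * Real.log t / Real.log Q)) + Real.exp (-Real.sqrt (κ * Real.log t)) with hDκ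
    have hDκ0 : 0 < Dκ := by positivity
    have hm0 : 0 ≤ m := le_min zero_le_one (by nlinarith)
    have hg0 : 0 ≤ g := le_trans (by positivity) hmain
    -- `A t Dκ m ≤ 4A Dκ g ≤ (4A+4) E g`
    have hineq : A * t * Dκ * m ≤ (4 * A + 4) * ThornerZaman.errorTermN c₂ Q n t * g := by
      have h2 : A * t * Dκ * m = A * Dκ * (t * m) := by ring
      have h3 : t * m ≤ 4 * g := by rw [hm, hg]; linarith
      have h4 : A * Dκ * (t * m) ≤ A * Dκ * (4 * g) := mul_le_mul_of_nonneg_left h3 (by positivity)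
      have h5 : A * Dκ * (4 * g) ≤ A * ThornerZaman.errorTermN c₂ Q n t * (4 * g) :=
        mul_le_mul_of_nonneg_right (mul_le_mul_of_nonneg_left hDE hA0.le) (by positivity)
      have hE0 : 0 ≤ ThornerZaman.errorTermN c₂ Q n t := (ThornerZaman.errorTermN_pos _ _ _ _).le
      have h6 : 0 ≤ ThornerZaman.errorTermN c₂ Q n t * g := mul_nonneg hE0 hg0
      nlinarith
    calc |chebyshevThetaIdealClass K C t - g / h|
        ≤ A * t * Dκ * m / h := h1
      _ ≤ (4 * A + 4) * ThornerZaman.errorTermN c₂ Q n t * g / h :=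
          div_le_div_of_nonneg_right hineq hh0.le
      _ = (4 * A + 4) * ThornerZaman.errorTermN c₂ Q n t * (g / h) := by ring
  · have hnoexc : ∀ (ψ : AddChar (Additive (ClassGroup (𝓞 K))) ℂ) (ρ : ℂ), famF K ψ ρ = 0 → 0 < ρ.re →
        ρ.re < 1 → ¬ excRegion c K ρ :=
      fun ψ ρ h0 h1 h2 h3 ↦ hex ⟨ψ, ρ, h0, h1, h2, h3⟩
    have hgood := hgoodK hnoexc
    by_cases hwide : ∃ (χ : ClassGroup (𝓞 K) →* ℂˣ) (β : ℝ), χ * χ = 1 ∧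
        1 - 1 / (8 * Real.log Q) < β ∧ β < 1 ∧ classGroupLFunction K χ β = 0
    · -- (1b) a real zero in the window but off the segment: its term is part of the error
      right
      obtain ⟨χ₀, β₀, hreal, hwin, hβ1, hL0⟩ := hwide
      obtain ⟨ψ₀, hψ₀⟩ := exists_toHomUnits_toMulHom_eq χ₀
      have hβ34 : 3 / 4 ≤ β₀ := by linarith
      have hβhalf : 1 / 2 ≤ β₀ := by linarith
      have hβpos : 0 < β₀ := by linarith
      have hβ1ne : ((β₀ : ℝ) : ℂ) ≠ 1 := by
        intro h'; apply hβ1.ne; exact_mod_cast h'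
      have hfam : famF K ψ₀ (β₀ : ℂ) = 0 :=
        famF_eq_zero_of_classGroupLFunction ψ₀ hβ1ne (by rw [hψ₀]; exact hL0)
      have hnot : ¬ excRegion c K (β₀ : ℂ) :=
        hnoexc ψ₀ (β₀ : ℂ) hfam (by rw [Complex.ofReal_re]; exact hβpos) (by rw [Complex.ofReal_re]; exact hβ1)
      have hfar : c / Real.log Q ≤ 1 - β₀ := one_sub_ge_of_not_excRegion (K := K) hK hc hnot
      have hδ : c₁ * Q ^ (-(2 : ℝ)) ≤ 1 - β₀ := heffK χ₀ hreal β₀ hβ1 hL0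
      refine ⟨χ₀, β₀, hreal, hwin, hβ1, hL0, hstark.trans hδ, fun C t ht ↦ ?_⟩
      obtain ⟨hta₂, ht1, hL16, hexp8, hDE, hcE⟩ := hsz t ht
      have ht0 : 0 < t := by linarith
      have h1 := hgood t hta₂ C
      have hr := abs_re_classGroupChar_apply_le hreal C
      set r : ℝ := ((χ₀ C : ℂ)).re with hrdef
      set Dκ : ℝ := Real.exp (-(κ * Real.log t / Real.log Q)) + Real.exp (-Real.sqrt (κ * Real.log t)) with hDκ
      set E : ℝ := ThornerZaman.errorTermN c₂ Q n t with hEdef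
      have hE0 : 0 < E := ThornerZaman.errorTermN_pos _ _ _ _
      -- `t^{β₀} = t e^{-(1-β₀) log t}` and `e^{-(1-β₀) log t} ≤ e^{-c log t/log Q} ≤ 1/8`
      have hexpβ : Real.exp (-((1 - β₀) * Real.log t)) ≤ Real.exp (-(c * Real.log t / Real.log Q)) := by
        rw [Real.exp_le_exp, neg_le_neg_iff]
        have := mul_le_mul_of_nonneg_right hfar (by linarith : (0 : ℝ) ≤ Real.log t)
        rw [div_mul_eq_mul_div] at this
        exact this
      have hfar8 : Real.exp (-((1 - β₀) * Real.log t)) ≤ 1 / 8 := hexpβ.trans hexp8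
      obtain ⟨hg, hrt⟩ := main_ge_half_of_far ht1 hr hβhalf hfar8
      have htβ : t ^ β₀ = t * Real.exp (-((1 - β₀) * Real.log t)) := by
        rw [Real.rpow_def_of_pos ht0, show Real.log t * β₀ = Real.log t + -((1 - β₀) * Real.log t) by ring,
          Real.exp_add, Real.exp_log ht0]
      -- `|r| t^{β₀}/β₀ ≤ 2 t E`
      have hrt2 : |r| * (t ^ β₀ / β₀) ≤ 2 * t * E := by
        have h2 : t ^ β₀ / β₀ ≤ 2 * t * Real.exp (-((1 - β₀) * Real.log t)) := by
          rw [div_le_iff₀ hβpos, htβ]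
          have : 0 ≤ t * Real.exp (-((1 - β₀) * Real.log t)) := by positivity
          nlinarith
        calc |r| * (t ^ β₀ / β₀) ≤ 1 * (2 * t * Real.exp (-((1 - β₀) * Real.log t))) :=
              mul_le_mul hr h2 (by positivity) zero_le_one
          _ ≤ 2 * t * E := by
              rw [one_mul]; exact mul_le_mul_of_nonneg_left (hexpβ.trans hcE) (by positivity)
      set g : ℝ := t - r * t ^ β₀ / β₀ with hgdef
      -- `|θ − g/h| ≤ |θ − t/h| + |r| t^β₀/(β₀ h) ≤ (A t Dκ + 2 t E)/h ≤ (A+2) t E / h ≤ (4A+4) E g / h`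
      have hθg : |chebyshevThetaIdealClass K C t - g / h| ≤ (A * t * Dκ + 2 * t * E) / h := by
        have e1 : chebyshevThetaIdealClass K C t - g / h =
            (chebyshevThetaIdealClass K C t - t / h) + r * (t ^ β₀ / β₀) / h := by
          rw [hgdef]; field_simp; ring
        rw [e1]
        refine (abs_add_le _ _).trans ?_
        rw [add_div]
        refine add_le_add h1 ?_
        rw [abs_div, abs_of_pos hh0, abs_mul]
        refine div_le_div_of_nonneg_right ?_ hh0.le
        rw [abs_of_nonneg (by positivity : (0 : ℝ) ≤ t ^ β₀ / β₀)]
        exact hrt2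
      have hineq : A * t * Dκ + 2 * t * E ≤ (4 * A + 4) * E * g := by
        have h2 : A * t * Dκ ≤ A * t * E := mul_le_mul_of_nonneg_left hDE (by positivity)
        have h3 : (A + 2) * t * E ≤ (4 * A + 4) * E * g := by
          have h4 : t ≤ 2 * g := by linarith
          have h5 : (A + 2) * t * E = (A + 2) * E * t := by ring
          rw [h5]
          have h6 : (A + 2) * E * t ≤ (A + 2) * E * (2 * g) := mul_le_mul_of_nonneg_left h4 (by positivity)
          have h7 : 0 ≤ E * g := by nlinarith
          nlinarith
        nlinarith
      calc |chebyshevThetaIdealClass K C t - g / h| ≤ (A * t * Dκ + 2 * t * E) / h := hθg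
        _ ≤ (4 * A + 4) * E * g / h := div_le_div_of_nonneg_right hineq hh0.le
        _ = (4 * A + 4) * E * (g / h) := by ring
    · -- (2) no real zero in the window: the first branch
      left
      refine ⟨fun χ hχ β hβw hβ1 hL0 ↦ hwide ⟨χ, β, hχ, hβw, hβ1, hL0⟩, fun C t ht ↦ ?_⟩
      obtain ⟨hta₂, ht1, -, -, hDE, -⟩ := hsz t ht
      have ht0 : 0 < t := by linarith
      have h1 := hgood t hta₂ C
      have hE0 : 0 ≤ ThornerZaman.errorTermN c₂ Q n t := (ThornerZaman.errorTermN_pos _ _ _ _).le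
      have hineq : A * t * (Real.exp (-(κ * Real.log t / Real.log Q)) + Real.exp (-Real.sqrt (κ * Real.log t)))
          ≤ (4 * A + 4) * ThornerZaman.errorTermN c₂ Q n t * t := by
        have h2 := mul_le_mul_of_nonneg_left hDE (by positivity : (0 : ℝ) ≤ A * t)
        have h3 : 0 ≤ ThornerZaman.errorTermN c₂ Q n t * t := by positivity
        nlinarith
      calc |chebyshevThetaIdealClass K C t - t / h|
          ≤ A * t * (Real.exp (-(κ * Real.log t / Real.log Q)) + Real.exp (-Real.sqrt (κ * Real.log t))) / h := h1
        _ ≤ (4 * A + 4) * ThornerZaman.errorTermN c₂ Q n t * t / h := div_le_div_of_nonneg_right hineq hh0.le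
        _ = (4 * A + 4) * ThornerZaman.errorTermN c₂ Q n t * (t / h) := by ring

end Literature.NumberTheory.LFunctions.NumberField.ClassPNT

end Part12

/-! ## Part 13 — the EXACT discharge `ThornerZaman2019_classPNT_imaginaryQuadratic_holds` -/

namespace Literature.NumberTheory.LFunctions.NumberField

/-- **The named fact `ThornerZaman2019_classPNT_imaginaryQuadratic` HOLDS**: Thorner–Zaman (2019) Thm. 1.4 for
the ideal classes of imaginary quadratic fields — `π_C(x) = h⁻¹ (Li(x) − θ₁ Li(x^{β₁}))(1 + E)`,
`|E| ≤ c₃ (e^{−c₂ log x/log(4|d_K|)} + e^{−(c₂ log x/2)^{1/2}})` for `x ≥ (4|d_K|)^{c₁}` (`UniformClassGroupPNT.lean`):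
`ClassPNT.classTheta_TZ_dichotomy 2` (this file) and the tree's reduction
`ThornerZaman2019_classPNT_imaginaryQuadratic_of_thetaForm` (`UniformClassGroupPNTReduction.lean`).  EXACT discharge,
Literature-side twin of `Summit.QuantumAdvantage.QuantumAdvantage.Theorems.DegreeOnePrimesEscape.
ThornerZaman2019_classPNT_imaginaryQuadratic_holds` (same proof).  The general-degree fact `…_hilbertClassField`
(constants uniform in the degree) is NOT claimed. [cite: ThornerZaman2019, Theorem 1.4] -/
theorem ThornerZaman2019_classPNT_imaginaryQuadratic_holds :
    ThornerZaman2019_classPNT_imaginaryQuadratic := by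
  obtain ⟨a, c₂, A, s, ha, hc₂, hA, hs, H⟩ := ClassPNT.classTheta_TZ_dichotomy 2 one_lt_two
  refine ThornerZaman2019_classPNT_imaginaryQuadratic_of_thetaForm ⟨a, c₂, A, s, ha, hc₂, hA, hs, ?_⟩
  intro K _ _ h2 _
  have hK := H K h2
  rw [ThornerZaman.condQn_eq_condQ K h2] at hK
  simp only [ThornerZaman.errorTermN_two] at hK
  exact hK

end Literature.NumberTheory.LFunctions.NumberField

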